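import Literature.Analysis.Complex.BacklundJensenAverage
import Literature.Analysis.SpecialFunctions.GammaVerticalBoundsSharp
import Literature.NumberTheory.LFunctions.ZetaConvexityExplicit
import Literature.NumberTheory.LFunctions.LehmanCriticalLineBoundProofs
import Literature.NumberTheory.LFunctions.TuringMethodTuringBound
import Literature.NumberTheory.LFunctions.ZetaEulerLowerBound
import Literature.NumberTheory.LFunctions.LogZetaConvex
import Literature.NumberTheory.LFunctions.ZetaZeroCountExplicit
import Literature.NumberTheory.LFunctions.ZetaZerosProofs
import Mathlib.NumberTheory.Harmonic.ZetaAsymp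
import HarnessLib

/-!
# An explicit Backlund bound: `|S(T)| ≤ 0.3083 log T + 3.24` for `T ≥ 30`, and
# Corollary 1.2 of Hasanalizade–Shen–Wong from their Theorem 1.3 alone

Topic `Literature/NumberTheory/LFunctions` (trunk T-ANT, family RH).  Everything in this file is
PROVED; there are no named facts and no definitions (the explicit majorant is a variable `Fm` with a
hypothesis `hF` spelling it out).

## Main results

* `Literature.NumberTheory.LFunctions.abs_zetaArgS_le_explicit` — **for every `T ≥ 30`,
  `|S(T)| ≤ 0.3083 log T + 3.24`** (`S = Literature.zetaArgS`, Backlund's normalisation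
  `S(T) = N(T) − θ(T)/π − 1`).  A Backlund-type theorem (Backlund 1918: `0.137 log T + 0.443 log log T
  + 4.35`; Trudgian 2014; Hasanalizade–Shen–Wong 2022: `0.1038 log T + …`), with a weaker slope because
  only the *convexity* bound for `ζ` is available in the tree, but fully formal.
* `Literature.NumberTheory.LFunctions.zetaZeroCount_hasanalizade_shen_wong_of_large` — the named fact
  `Literature.NumberTheory.LFunctions.zetaZeroCount_hasanalizade_shen_wong` ([HSW2022, Cor. 1.2]:
  `|N(T) − (T/2π)log(T/2πe)| ≤ 0.1038 log T + 0.2573 log log T + 9.3675`, `T ≥ e`) follows from the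
  single analytic input **[HSW2022, Thm. 1.3 at Table 2, row 1]** (`|S(T)| ≤ 0.103787 log T +
  0.257297 log log T + 8.367419` for `T ≥ 30 610 046 000`).  The source uses, below `T₀`, Platt's
  database of the `10¹¹` zeros up to height `T₀` ((1.7): `|S(T)| ≤ 2.5167`); here that computational
  input is replaced by the theorem above (at `T = T₀` it still gives
  `|N − M| ≤ 0.3083·24.26 + 4.13 < 9.3675 + 0.1038 log T₀`) and by `N(T) ≤ N(30) ≤ 7`,
  `−1 ≤ M(T) ≤ 2.81` on `[e, 30]`.  (Companion of `ZetaZeroCountExplicit.lean`, which isolates the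
  two inputs of the printed proof.)
* `Literature.NumberTheory.LFunctions.abs_zetaZeroCount_sub_main_le_explicit(')` — unconditionally,
  `|N(T) − (T/2π)log(T/2πe)| ≤ 0.3083 log T + 4.128` for `T ≥ 30`, `≤ 0.3083 log T + 7.7` for `T ≥ e`.

## The proof of the Backlund bound

Backlund's formula `π S(T) = Im(i∫₀ᵀ ζ'/ζ(2+iy)dy) − Im ∫_{1/2}^2 ζ'/ζ(x+iT)dx`
(`Literature.NumberTheory.LFunctions.pi_mul_zetaArgS_eq`, `T` not an ordinate).
1. Vertical term `≤ 0.71`: `arg ζ(2) = 0`, `|ζ(2+iT) − 1| ≤ π²/6 − 1`, and for `|z − 1| ≤ ρ`,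
   `|Im z| ≤ ρ|z|`, so `|arg ζ(2+iT)| ≤ arcsin(π²/6 − 1) < 0.71`
   (`abs_im_integral_logDeriv_riemannZeta_vertical_le_sharp`).
2. Horizontal term by the sharp Backlund lemma
   `Literature.Analysis.Complex.abs_im_integral_logDeriv_le_of_circleAverage_le`
   (`BacklundJensenAverage.lean`: Jensen with the circle *mean* and the `N`-th power trick, no `+1`)
   on `|s − (5/4 + iT)| ≤ 3/4 < 3/2`: `|Im ∫| ≤ π (A − log|ζ(5/4+iT)|)/log 2`, with
   `log|ζ(5/4+iT)| ≥ log(ζ(5/2)/ζ(5/4)) ≥ −1.247` (Euler product,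
   `Literature.NumberTheory.LFunctions.norm_riemannZeta_ge_div`, and `ζ(5/4) ≤ 4.63136`,
   `ζ(5/2) ≥ 1.33179` by the integral test) and `A` the circle average of the logarithm `F` of a
   majorant of `|ζ|` on the circle, depending on `σ = Re s` only:
   * `σ ≥ σs = 5/4 + 3√3/4` (`θ ≤ π/6`): `ζ(5/2) ≤ e^{0.3043}`; `2 ≤ σ < σs`: `ζ(2) = π²/6 ≤ e^{0.4978}`;
   * `5/4 ≤ σ < 2` (`π/3 < θ ≤ π/2`): the chord of the convex `log ζ(σ)`
     (`Literature.NumberTheory.LFunctions.convexOn_log_re_riemannZeta`) through `ζ(5/4) ≤ e^{1.533}`, `ζ(2)`;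
   * `1/2 ≤ σ < 5/4` (`π/2 < θ ≤ 2π/3`): the Rademacher–Trudgian convexity estimate
     `Literature.NumberTheory.LFunctions.norm_riemannZeta_le_convexity` from the tree's proved
     critical-line bound `|ζ(½+it)| ≤ 2.53|3+it|^{1/4}` (`Trudgian2011_lemma_2_5_allT_holds`) and
     `ζ(5/4)`, in exponential form `f₂` (`norm_riemannZeta_le_exp_f₂`);
   * `−1/4 ≤ σ < 1/2` (`2π/3 < θ ≤ π`): the functional equation with the factor
     `e^{1/2}(|t|/2π)^{1/2−σ}` (`Literature.Analysis.SpecialFunctions.GammaVert.norm_fe_factor_le_sharp`,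
     `GammaVerticalBoundsSharp.lean`) and then `f₂` at `1 − σ` (`f₃`, `norm_riemannZeta_le_exp_f₃`).
   The regions change exactly at the angles `π/6, π/3, π/2, 2π/3`, so on each arc `F(5/4 + (3/2)cos θ)`
   is affine in `cos θ` and `∫₀^π F` is computed in closed form (`integral_F_le`); the half-circle
   reduction is `circleAverage_re_eq'`.
3. Numerics (`final_numeric`): `0.71/π + (∫₀^π F/π + 1.247)/log 2 ≤ 0.3083 ℓ + 3.24` for `ℓ ≥ 3.401`,
   from `π` to six places, `√3` to seven, `log 2` to nine.
4. Ordinates: `abs_zetaArgS_le_explicit` passes from non-ordinates `T'' ↓ T` (`N(T'') = N(T)`) by the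
   continuity of `θ` and of the bound.

## References

* R. J. Backlund, *Über die Nullstellen der Riemannschen Zetafunktion*, Acta Math. 41 (1918) 345–375.
* E. C. Titchmarsh, *The Theory of the Riemann Zeta-Function*, 2nd ed. (1986), §9.3–9.4, §4.12.
* E. Hasanalizade, Q. Shen, P.-J. Wong, *Counting zeros of the Riemann zeta function*, J. Number
  Theory 235 (2022) 219–241, Thm. 1.3, Cor. 1.2, (1.7), §5. [HasanalizadeShenWong2022]
* T. S. Trudgian, *Improvements to Turing's method*, Math. Comp. 80 (2011), Lemmas 2.5, 2.7.
  [Trudgian2011]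
* H. Rademacher, *On the Phragmén–Lindelöf theorem and some applications*, Math. Z. 72 (1959), Thm 2.
  [Rademacher1959]
-/

noncomputable section

open Complex Set MeasureTheory Filter Topology intervalIntegral Metric Real
open scoped Real ComplexConjugate

namespace Literature.NumberTheory.LFunctions

namespace ZetaArgBacklund

/-! ### Numerical constants -/

/-- `log 2.53 ≤ 0.9283`. [folklore] -/
lemma log_K_le : Real.log 2.53 ≤ 0.9283 := by
  rw [Real.log_le_iff_le_exp (by norm_num)]
  refine le_trans ?_ (Real.sum_le_exp_of_nonneg (by norm_num) 7)
  norm_num [Finset.sum_range_succ, Nat.factorial]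

/-- `4.63136 ≤ e^{1.533}`. [folklore] -/
lemma exp_Z₁_ge : (4.63136 : ℝ) ≤ Real.exp 1.533 := by
  refine le_trans ?_ (Real.sum_le_exp_of_nonneg (by norm_num) 9)
  norm_num [Finset.sum_range_succ, Nat.factorial]

/-- `1.35553 ≤ e^{0.3043}`. [folklore] -/
lemma exp_L52_ge : (1.35553 : ℝ) ≤ Real.exp 0.3043 := by
  refine le_trans ?_ (Real.sum_le_exp_of_nonneg (by norm_num) 5)
  norm_num [Finset.sum_range_succ, Nat.factorial]

/-- `4.63136 / 1.33179 ≤ e^{1.247}`. [folklore] -/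
lemma exp_L₀_ge : (4.63136 / 1.33179 : ℝ) ≤ Real.exp 1.247 := by
  refine le_trans ?_ (Real.sum_le_exp_of_nonneg (by norm_num) 7)
  norm_num [Finset.sum_range_succ, Nat.factorial]

/-- `π²/6 ≤ e^{0.4978}`. [folklore] -/
lemma pi_sq_div_six_le_exp : π ^ 2 / 6 ≤ Real.exp 0.4978 := by
  refine le_trans ?_ (Real.sum_le_exp_of_nonneg (by norm_num) 6)
  have := Real.pi_lt_d6
  have h0 := Real.pi_pos
  norm_num [Finset.sum_range_succ, Nat.factorial]
  nlinarith

/-- `1.05 · e^{1.788} ≤ 2π` (i.e. `log(2π) − log 1.05 ≥ 1.788`). [folklore] -/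
lemma exp_mul_le_two_pi : 1.05 * Real.exp 1.788 ≤ 2 * π := by
  have h1 : Real.exp 1.788 = Real.exp 1 * Real.exp 0.788 := by
    rw [← Real.exp_add]; norm_num
  have h2 : Real.exp 0.788 ≤ 2.2002 := by
    refine (Real.exp_bound' (by norm_num) (by norm_num) (n := 4) (by norm_num)).trans ?_
    norm_num [Finset.sum_range_succ, Nat.factorial]
  have h3 := Real.exp_one_lt_d9
  have h4 := Real.pi_gt_d6
  rw [h1]
  nlinarith [Real.exp_pos 1, Real.exp_pos 0.788]

/-- `e^{3.401} ≤ 30` (i.e. `log 30 ≥ 3.401`). [folklore] -/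
lemma exp_le_thirty : Real.exp 3.401 ≤ 30 := by
  have h1 : Real.exp 3.401 = Real.exp 1 ^ 3 * Real.exp 0.401 := by
    rw [← Real.exp_nat_mul, ← Real.exp_add]; norm_num
  have h2 : Real.exp 0.401 ≤ 1.4935 := by
    refine (Real.exp_bound' (by norm_num) (by norm_num) (n := 4) (by norm_num)).trans ?_
    norm_num [Finset.sum_range_succ, Nat.factorial]
  have h3 := Real.exp_one_lt_d9
  have h0 : 0 < Real.exp 1 := Real.exp_pos 1
  rw [h1]
  have h4 : Real.exp 1 ^ 3 ≤ 2.7182818286 ^ 3 := by gcongr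
  have h5 : (0 : ℝ) ≤ Real.exp 0.401 := (Real.exp_pos _).le
  nlinarith

/-- `√3` to seven places. [folklore] -/
lemma sqrt_three_bounds : 1.7320508 < Real.sqrt 3 ∧ Real.sqrt 3 < 1.7320509 := by
  constructor
  · rw [Real.lt_sqrt (by norm_num)]; norm_num
  · rw [Real.sqrt_lt' (by norm_num)]; norm_num

/-! ### Values of `ζ` on the real axis -/

/-- `x^{-5/4} ≤ q` from `1 ≤ q⁴ x⁵` (`x, q > 0`). [folklore] -/
lemma rpow_neg_five_fourths_le {x q : ℝ} (hx : 0 < x) (hq : 0 < q) (h : 1 ≤ q ^ 4 * x ^ 5) :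
    x ^ (-(5 / 4 : ℝ)) ≤ q := by
  have h1 : x ^ (-(5 / 4 : ℝ)) = (x ^ 5)⁻¹ ^ (1 / 4 : ℝ) := by
    rw [← Real.rpow_natCast, ← Real.rpow_neg_one, ← Real.rpow_mul hx.le, ← Real.rpow_mul hx.le]
    norm_num
  rw [h1]
  have h2 : q = (q ^ 4) ^ (1 / 4 : ℝ) := by
    rw [← Real.rpow_natCast, ← Real.rpow_mul hq.le]; norm_num
  rw [h2]
  refine Real.rpow_le_rpow (by positivity) ?_ (by norm_num)
  rw [← one_div, div_le_iff₀ (by positivity)]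
  linarith

/-- `x^{-1/4} ≤ q` from `1 ≤ q⁴ x`. [folklore] -/
lemma rpow_neg_quarter_le {x q : ℝ} (hx : 0 < x) (hq : 0 < q) (h : 1 ≤ q ^ 4 * x) :
    x ^ (-(1 / 4 : ℝ)) ≤ q := by
  have h1 : x ^ (-(1 / 4 : ℝ)) = x⁻¹ ^ (1 / 4 : ℝ) := by
    rw [← Real.rpow_neg_one, ← Real.rpow_mul hx.le]; norm_num
  rw [h1]
  have h2 : q = (q ^ 4) ^ (1 / 4 : ℝ) := by
    rw [← Real.rpow_natCast, ← Real.rpow_mul hq.le]; norm_num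
  rw [h2]
  refine Real.rpow_le_rpow (by positivity) ?_ (by norm_num)
  rw [← one_div, div_le_iff₀ hx]
  linarith

/-- `x^{-5/2} ≤ q` from `1 ≤ q² x⁵`. [folklore] -/
lemma rpow_neg_five_halves_le {x q : ℝ} (hx : 0 < x) (hq : 0 < q) (h : 1 ≤ q ^ 2 * x ^ 5) :
    x ^ (-(5 / 2 : ℝ)) ≤ q := by
  have h1 : x ^ (-(5 / 2 : ℝ)) = (x ^ 5)⁻¹ ^ (1 / 2 : ℝ) := by
    rw [← Real.rpow_natCast, ← Real.rpow_neg_one, ← Real.rpow_mul hx.le, ← Real.rpow_mul hx.le]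
    norm_num
  rw [h1]
  have h2 : q = (q ^ 2) ^ (1 / 2 : ℝ) := by
    rw [← Real.rpow_natCast, ← Real.rpow_mul hq.le]; norm_num
  rw [h2]
  refine Real.rpow_le_rpow (by positivity) ?_ (by norm_num)
  rw [← one_div, div_le_iff₀ (by positivity)]
  linarith

/-- `q ≤ x^{-5/2}` from `q² x⁵ ≤ 1`. [folklore] -/
lemma le_rpow_neg_five_halves {x q : ℝ} (hx : 0 < x) (hq : 0 < q) (h : q ^ 2 * x ^ 5 ≤ 1) :
    q ≤ x ^ (-(5 / 2 : ℝ)) := by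
  have h1 : x ^ (-(5 / 2 : ℝ)) = (x ^ 5)⁻¹ ^ (1 / 2 : ℝ) := by
    rw [← Real.rpow_natCast, ← Real.rpow_neg_one, ← Real.rpow_mul hx.le, ← Real.rpow_mul hx.le]
    norm_num
  rw [h1]
  have h2 : q = (q ^ 2) ^ (1 / 2 : ℝ) := by
    rw [← Real.rpow_natCast, ← Real.rpow_mul hq.le]; norm_num
  rw [h2]
  refine Real.rpow_le_rpow (by positivity) ?_ (by norm_num)
  rw [← one_div, le_div_iff₀ (by positivity)]
  linarith

/-- `q ≤ x^{-3/2}` from `q² x³ ≤ 1`. [folklore] -/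
lemma le_rpow_neg_three_halves {x q : ℝ} (hx : 0 < x) (hq : 0 < q) (h : q ^ 2 * x ^ 3 ≤ 1) :
    q ≤ x ^ (-(3 / 2 : ℝ)) := by
  have h1 : x ^ (-(3 / 2 : ℝ)) = (x ^ 3)⁻¹ ^ (1 / 2 : ℝ) := by
    rw [← Real.rpow_natCast, ← Real.rpow_neg_one, ← Real.rpow_mul hx.le, ← Real.rpow_mul hx.le]
    norm_num
  rw [h1]
  have h2 : q = (q ^ 2) ^ (1 / 2 : ℝ) := by
    rw [← Real.rpow_natCast, ← Real.rpow_mul hq.le]; norm_num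
  rw [h2]
  refine Real.rpow_le_rpow (by positivity) ?_ (by norm_num)
  rw [← one_div, le_div_iff₀ (by positivity)]
  linarith

/-- **`ζ(5/4) ≤ 4.63136`** (eight terms and the integral test). [folklore] -/
theorem re_riemannZeta_five_fourths_le : (riemannZeta ((5 / 4 : ℝ) : ℂ)).re ≤ 4.63136 := by
  have h := re_riemannZeta_ofReal_le_sum_add (σ := 5 / 4) (by norm_num) (N := 8) (by norm_num)
  refine h.trans ?_
  simp only [Finset.sum_range_succ, Finset.sum_range_zero, zero_add, Nat.cast_zero, Nat.cast_ofNat,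
    Nat.cast_one]
  have t1 : ((0 : ℝ) + 1) ^ (-(5 / 4 : ℝ)) = 1 := by norm_num
  have t2 : ((1 : ℝ) + 1) ^ (-(5 / 4 : ℝ)) ≤ 0.42045 :=
    rpow_neg_five_fourths_le (by norm_num) (by norm_num) (by norm_num)
  have t3 : ((2 : ℝ) + 1) ^ (-(5 / 4 : ℝ)) ≤ 0.25328 :=
    rpow_neg_five_fourths_le (by norm_num) (by norm_num) (by norm_num)
  have t4 : ((3 : ℝ) + 1) ^ (-(5 / 4 : ℝ)) ≤ 0.17678 :=
    rpow_neg_five_fourths_le (by norm_num) (by norm_num) (by norm_num)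
  have t5 : ((4 : ℝ) + 1) ^ (-(5 / 4 : ℝ)) ≤ 0.13375 :=
    rpow_neg_five_fourths_le (by norm_num) (by norm_num) (by norm_num)
  have t6 : ((5 : ℝ) + 1) ^ (-(5 / 4 : ℝ)) ≤ 0.10650 :=
    rpow_neg_five_fourths_le (by norm_num) (by norm_num) (by norm_num)
  have t7 : ((6 : ℝ) + 1) ^ (-(5 / 4 : ℝ)) ≤ 0.08783 :=
    rpow_neg_five_fourths_le (by norm_num) (by norm_num) (by norm_num)
  have t8 : ((7 : ℝ) + 1) ^ (-(5 / 4 : ℝ)) ≤ 0.07433 :=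
    rpow_neg_five_fourths_le (by norm_num) (by norm_num) (by norm_num)
  have t9 : (8 : ℝ) ^ (1 - 5 / 4 : ℝ) / (5 / 4 - 1) ≤ 2.37844 := by
    rw [show (1 - 5 / 4 : ℝ) = -(1 / 4) by norm_num]
    have := rpow_neg_quarter_le (x := 8) (q := 0.59461) (by norm_num) (by norm_num) (by norm_num)
    rw [div_le_iff₀ (by norm_num)]
    linarith
  linarith

/-- **`1.33179 ≤ ζ(5/2) ≤ 1.35553`** (four terms and the integral test). [folklore] -/
theorem re_riemannZeta_five_halves_bounds :
    1.33179 ≤ (riemannZeta ((5 / 2 : ℝ) : ℂ)).re ∧ (riemannZeta ((5 / 2 : ℝ) : ℂ)).re ≤ 1.35553 := by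
  constructor
  · have h := sum_add_le_re_riemannZeta_ofReal (σ := 5 / 2) (by norm_num) 4
    refine le_trans ?_ h
    simp only [Finset.sum_range_succ, Finset.sum_range_zero, zero_add, Nat.cast_zero,
      Nat.cast_ofNat, Nat.cast_one]
    have t1 : ((0 : ℝ) + 1) ^ (-(5 / 2 : ℝ)) = 1 := by norm_num
    have t2 : (0.17677 : ℝ) ≤ ((1 : ℝ) + 1) ^ (-(5 / 2 : ℝ)) :=
      le_rpow_neg_five_halves (by norm_num) (by norm_num) (by norm_num)
    have t3 : (0.06415 : ℝ) ≤ ((2 : ℝ) + 1) ^ (-(5 / 2 : ℝ)) :=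
      le_rpow_neg_five_halves (by norm_num) (by norm_num) (by norm_num)
    have t4 : (0.03125 : ℝ) ≤ ((3 : ℝ) + 1) ^ (-(5 / 2 : ℝ)) :=
      le_rpow_neg_five_halves (by norm_num) (by norm_num) (by norm_num)
    have t5 : (0.05962 : ℝ) ≤ ((4 : ℝ) + 1) ^ (1 - 5 / 2 : ℝ) / (5 / 2 - 1) := by
      rw [show (1 - 5 / 2 : ℝ) = -(3 / 2) by norm_num, le_div_iff₀ (by norm_num)]
      have := le_rpow_neg_three_halves (x := (4 : ℝ) + 1) (q := 0.08943) (by norm_num) (by norm_num)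
        (by norm_num)
      linarith
    linarith
  · have h := re_riemannZeta_ofReal_le_sum_add (σ := 5 / 2) (by norm_num) (N := 4) (by norm_num)
    refine h.trans ?_
    simp only [Finset.sum_range_succ, Finset.sum_range_zero, zero_add, Nat.cast_zero,
      Nat.cast_ofNat, Nat.cast_one]
    have t1 : ((0 : ℝ) + 1) ^ (-(5 / 2 : ℝ)) = 1 := by norm_num
    have t2 : ((1 : ℝ) + 1) ^ (-(5 / 2 : ℝ)) ≤ 0.17678 :=
      rpow_neg_five_halves_le (by norm_num) (by norm_num) (by norm_num)
    have t3 : ((2 : ℝ) + 1) ^ (-(5 / 2 : ℝ)) ≤ 0.06416 :=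
      rpow_neg_five_halves_le (by norm_num) (by norm_num) (by norm_num)
    have t4 : ((3 : ℝ) + 1) ^ (-(5 / 2 : ℝ)) ≤ 0.03125 :=
      rpow_neg_five_halves_le (by norm_num) (by norm_num) (by norm_num)
    have t5 : (4 : ℝ) ^ (1 - 5 / 2 : ℝ) / (5 / 2 - 1) ≤ 0.08334 := by
      rw [show (1 - 5 / 2 : ℝ) = -(3 / 2) by norm_num, div_le_iff₀ (by norm_num)]
      have : (4 : ℝ) ^ (-(3 / 2 : ℝ)) = 1 / 8 := by
        rw [show (4 : ℝ) = 2 ^ (2 : ℝ) by norm_num, ← Real.rpow_mul (by norm_num)]; norm_num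
      rw [this]; norm_num
    linarith

/-! ### `ζ` on the real axis: monotonicity and the chord on `[5/4, 2]` -/

/-- `ζ` is decreasing on the real axis `σ > 1`. [folklore] -/
theorem re_riemannZeta_ofReal_antitone {a b : ℝ} (ha : 1 < a) (hab : a ≤ b) :
    (riemannZeta (b : ℂ)).re ≤ (riemannZeta (a : ℂ)).re := by
  have hb : 1 < b := lt_of_lt_of_le ha hab
  rw [re_riemannZeta_ofReal_eq_tsum ha, re_riemannZeta_ofReal_eq_tsum hb]
  refine Summable.tsum_le_tsum (fun n ↦ ?_) (summable_nat_add_one_rpow_neg hb)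
    (summable_nat_add_one_rpow_neg ha)
  exact Real.rpow_le_rpow_of_exponent_le (by linarith) (by linarith)

/-- `log ζ(5/4) ≤ 1.533`. [folklore] -/
lemma log_re_riemannZeta_five_fourths_le : Real.log (riemannZeta ((5 / 4 : ℝ) : ℂ)).re ≤ 1.533 := by
  have h1 := re_riemannZeta_five_fourths_le
  have h0 : 0 < (riemannZeta ((5 / 4 : ℝ) : ℂ)).re :=
    lt_of_lt_of_le one_pos (one_le_re_riemannZeta_ofReal (by norm_num))
  rw [Real.log_le_iff_le_exp h0]
  exact h1.trans exp_Z₁_ge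

/-- `log ζ(5/2) ≤ 0.3043`. [folklore] -/
lemma log_re_riemannZeta_five_halves_le : Real.log (riemannZeta ((5 / 2 : ℝ) : ℂ)).re ≤ 0.3043 := by
  have h1 := re_riemannZeta_five_halves_bounds.2
  have h0 : 0 < (riemannZeta ((5 / 2 : ℝ) : ℂ)).re :=
    lt_of_lt_of_le one_pos (one_le_re_riemannZeta_ofReal (by norm_num))
  rw [Real.log_le_iff_le_exp h0]
  exact h1.trans exp_L52_ge

/-- `ζ(2) = π²/6` on the real axis, and `log ζ(2) ≤ 0.4978`. [folklore] -/
lemma re_riemannZeta_two : (riemannZeta ((2 : ℝ) : ℂ)).re = π ^ 2 / 6 := by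
  rw [show ((2 : ℝ) : ℂ) = 2 by norm_num, riemannZeta_two]
  norm_cast

/-- `log ζ(2) ≤ 0.4978`. [folklore] -/
lemma log_re_riemannZeta_two_le : Real.log (riemannZeta ((2 : ℝ) : ℂ)).re ≤ 0.4978 := by
  rw [re_riemannZeta_two, Real.log_le_iff_le_exp (by positivity)]
  exact pi_sq_div_six_le_exp

/-- The lower bound at the centre: `log(ζ(5/2)/ζ(5/4)) ≥ -1.247`, whence
`-1.247 ≤ log |ζ(5/4 + it)|`. [folklore] -/
lemma neg_le_log_norm_riemannZeta_five_fourths_add (t : ℝ) :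
    -1.247 ≤ Real.log ‖riemannZeta ((5 / 4 : ℝ) + t * I)‖ := by
  have hre : (((5 / 4 : ℝ) : ℂ) + t * I).re = 5 / 4 := by simp
  have hs : 1 < (((5 / 4 : ℝ) : ℂ) + t * I).re := by rw [hre]; norm_num
  have h := norm_riemannZeta_ge_div hs
  rw [hre, show ((2 * (5 / 4) : ℝ) : ℂ) = ((5 / 2 : ℝ) : ℂ) by norm_num] at h
  rw [norm_riemannZeta_ofReal_eq_re (by norm_num : (1 : ℝ) < 5 / 2),
    norm_riemannZeta_ofReal_eq_re (by norm_num : (1 : ℝ) < 5 / 4)] at h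
  have h54 := re_riemannZeta_five_fourths_le
  have h52 := re_riemannZeta_five_halves_bounds.1
  have h54pos : 0 < (riemannZeta ((5 / 4 : ℝ) : ℂ)).re :=
    lt_of_lt_of_le one_pos (one_le_re_riemannZeta_ofReal (by norm_num))
  have hq : Real.exp (-1.247) ≤ (riemannZeta ((5 / 2 : ℝ) : ℂ)).re / (riemannZeta ((5 / 4 : ℝ) : ℂ)).re := by
    rw [Real.exp_neg, le_div_iff₀ h54pos]
    have hE := exp_L₀_ge
    have hEpos : 0 < Real.exp 1.247 := Real.exp_pos _
    rw [div_le_iff₀ (by norm_num)] at hE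
    rw [inv_mul_le_iff₀ hEpos]
    nlinarith
  have hpos : 0 < Real.exp (-1.247) := Real.exp_pos _
  have := Real.log_le_log hpos (hq.trans h)
  rwa [Real.log_exp] at this

/-! ### The functional equation with the sharp factor -/

/-- **`ζ` to the left of the critical line.** For `-1 ≤ σ ≤ 1/2` and `|t| ≥ 2`,
`|ζ(σ + it)| ≤ e^{1/2} (|t|/2π)^{1/2-σ} |ζ(1-σ+it)|` (functional equation, Mathlib's
`riemannZeta_one_sub`, and `Literature.Analysis.SpecialFunctions.GammaVert.norm_fe_factor_le_sharp`).
[cite: Titchmarsh1986, §4.12 (4.12.3)] -/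
theorem norm_riemannZeta_le_fe {σ t : ℝ} (hσ₁ : -1 ≤ σ) (hσ₂ : σ ≤ 1 / 2) (ht : 2 ≤ |t|) :
    ‖riemannZeta (σ + t * I)‖ ≤
      Real.exp (1 / 2) * (|t| / (2 * π)) ^ (1 / 2 - σ) * ‖riemannZeta (1 - σ + t * I)‖ := by
  set s : ℂ := 1 - ((σ : ℂ) + t * I) with hs
  have hsre : s.re = 1 - σ := by simp [hs]
  have hsim : s.im = -t := by simp [hs]
  have ht0 : t ≠ 0 := by intro h; rw [h] at ht; norm_num at ht
  have hsn : ∀ n : ℕ, s ≠ -n := fun n h ↦ by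
    have := congrArg Complex.im h; rw [hsim] at this; simp at this; exact ht0 this
  have hs1 : s ≠ 1 := fun h ↦ by
    have := congrArg Complex.im h; rw [hsim] at this; simp at this; exact ht0 this
  have hfe := riemannZeta_one_sub hsn hs1
  have h1s : 1 - s = (σ : ℂ) + t * I := by rw [hs]; ring
  rw [h1s] at hfe
  have hF := Literature.Analysis.SpecialFunctions.GammaVert.norm_fe_factor_le_sharp (s := s)
    (by rw [hsre]; linarith) (by rw [hsre]; linarith) (by rw [hsim, abs_neg]; exact ht)
  rw [hsre, hsim, abs_neg, show (1 : ℝ) - σ - 1 / 2 = 1 / 2 - σ by ring] at hF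
  have hconj : s = conj (1 - (σ : ℂ) + t * I) := by
    rw [hs]; apply Complex.ext <;> simp
  have hζs : ‖riemannZeta s‖ = ‖riemannZeta (1 - σ + t * I)‖ := by
    rw [hconj, riemannZeta_conj, Complex.norm_conj]
  rw [hfe, norm_mul, hζs]
  gcongr

/-! ### The vertical term: `|arg ζ(2+iT)| ≤ 0.71` -/

/-- If `|z - 1| ≤ ρ ≤ 1` then `|Im z| ≤ ρ |z|` (the tangent from the origin to the disc).
[folklore] -/
lemma abs_im_le_mul_norm_of_norm_sub_one_le {z : ℂ} {ρ : ℝ} (hρ : 0 ≤ ρ) (hρ1 : ρ ≤ 1)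
    (hz : ‖z - 1‖ ≤ ρ) : |z.im| ≤ ρ * ‖z‖ := by
  have h1 : (z.re - 1) ^ 2 + z.im ^ 2 ≤ ρ ^ 2 := by
    have : ‖z - 1‖ ^ 2 = (z.re - 1) ^ 2 + z.im ^ 2 := by
      rw [Complex.sq_norm, Complex.normSq_apply]; simp; ring
    rw [← this]; exact pow_le_pow_left₀ (norm_nonneg _) hz 2
  have h2 : ‖z‖ ^ 2 = z.re ^ 2 + z.im ^ 2 := by
    rw [Complex.sq_norm, Complex.normSq_apply]; ring
  have h3 : z.im ^ 2 ≤ ρ ^ 2 * ‖z‖ ^ 2 := by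
    rw [h2]
    have h5 : (1 - ρ ^ 2) * z.im ^ 2 ≤ (1 - ρ ^ 2) * (ρ ^ 2 - (z.re - 1) ^ 2) :=
      mul_le_mul_of_nonneg_left (by linarith) (sub_nonneg.2 (pow_le_one₀ (n := 2) hρ hρ1))
    nlinarith [h5, sq_nonneg (z.re - (1 - ρ ^ 2))]
  have h4 : |z.im| ^ 2 ≤ (ρ * ‖z‖) ^ 2 := by rw [sq_abs, mul_pow]; exact h3
  exact (pow_le_pow_iff_left₀ (abs_nonneg _) (by positivity) two_ne_zero).1 h4

/-- **The vertical term is at most `0.71`**: `Im(i ∫₀ᵀ ζ'/ζ(2+iy) dy) = arg ζ(2+iT) − arg ζ(2)`,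
`arg ζ(2) = 0`, and `|ζ(2+iT) − 1| ≤ π²/6 − 1 < sin 0.71`. [cite: Titchmarsh1986, §9.3] -/
theorem abs_im_integral_logDeriv_riemannZeta_vertical_le_sharp {T : ℝ} (hT : 0 ≤ T) :
    |(I * ∫ y in (0 : ℝ)..T, deriv riemannZeta (2 + y * I) / riemannZeta (2 + y * I)).im| ≤ 0.71 := by
  have hne1 : ∀ y : ℝ, ((2 : ℝ) : ℂ) + y * I ≠ 1 := fun y h ↦ by
    have := congrArg Complex.re h; norm_num at this
  have han : ∀ y ∈ Icc 0 T, AnalyticAt ℂ riemannZeta ((2 : ℝ) + y * I) := fun y _ ↦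
    analyticOn_riemannZeta _ (hne1 y)
  have hslit : ∀ y ∈ Icc 0 T, riemannZeta ((2 : ℝ) + y * I) ∈ slitPlane := fun y _ ↦
    Or.inl (by simpa using re_riemannZeta_two_add_pos y)
  have h := Literature.Analysis.Complex.integral_logDeriv_vertical (g := riemannZeta) 2 hT han hslit
  simp only [ofReal_ofNat] at h
  rw [h, sub_im, log_im, log_im]
  simp only [ofReal_zero, zero_mul, add_zero]
  -- `arg ζ(2) = 0`
  have h2 : arg (riemannZeta 2) = 0 := by
    rw [riemannZeta_two, show (π : ℂ) ^ 2 / 6 = ((π ^ 2 / 6 : ℝ) : ℂ) by push_cast; ring]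
    exact arg_ofReal_of_nonneg (by positivity)
  rw [h2, sub_zero]
  -- `|arg ζ(2+iT)| ≤ arcsin(π²/6 − 1) ≤ 0.71`
  set z := riemannZeta (2 + T * I) with hz
  have hρ : ‖z - 1‖ ≤ π ^ 2 / 6 - 1 := norm_riemannZeta_two_add_sub_one_le T
  have hπ := Real.pi_lt_d6
  have hπ' := Real.pi_gt_d6
  have hρ0 : 0 ≤ π ^ 2 / 6 - 1 := by nlinarith
  have hρ1 : π ^ 2 / 6 - 1 ≤ 0.645 := by nlinarith
  have hzre : 0 ≤ z.re := (re_riemannZeta_two_add_pos T).le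
  have hzpos : 0 < ‖z‖ := norm_pos_iff.2 (riemannZeta_two_add_ne_zero T)
  have him : |z.im| ≤ (π ^ 2 / 6 - 1) * ‖z‖ :=
    abs_im_le_mul_norm_of_norm_sub_one_le hρ0 (by linarith) hρ
  have hu : |z.im / ‖z‖| ≤ 0.645 := by
    rw [abs_div, abs_norm, div_le_iff₀ hzpos]; nlinarith
  rw [arg_of_re_nonneg hzre]
  have hsin : (0.645 : ℝ) ≤ Real.sin 0.71 := by
    have := Real.sin_gt_sub_cube (x := 0.71) (by norm_num)
    norm_num at this; linarith
  have hy : (0.71 : ℝ) ∈ Icc (-(π / 2)) (π / 2) := ⟨by linarith, by linarith⟩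
  obtain ⟨hu1, hu2⟩ := abs_le.1 hu
  rw [abs_le]
  constructor
  · have : Real.arcsin (-0.645) ≤ Real.arcsin (z.im / ‖z‖) := Real.arcsin_le_arcsin hu1
    have h3 : Real.arcsin (0.645 : ℝ) ≤ 0.71 :=
      (Real.arcsin_le_iff_le_sin ⟨by norm_num, by norm_num⟩ hy).2 hsin
    rw [Real.arcsin_neg] at this
    linarith
  · exact (Real.arcsin_le_arcsin hu2).trans ((Real.arcsin_le_iff_le_sin ⟨by norm_num, by norm_num⟩ hy).2 hsin)

/-! ### The majorant of `|ζ|` around the circle `|s - (5/4 + iT)| = 3/2` -/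

/-- Region `σ ≥ 5/2`: `|ζ(σ+it)| ≤ ζ(5/2) ≤ e^{0.3043}`. [folklore] -/
theorem norm_riemannZeta_le_exp_of_five_halves_le {w : ℂ} (hw : 5 / 2 ≤ w.re) :
    ‖riemannZeta w‖ ≤ Real.exp 0.3043 := by
  have h1 := norm_riemannZeta_le_re_riemannZeta (s := w) (by linarith)
  have h2 := re_riemannZeta_ofReal_antitone (by norm_num : (1 : ℝ) < 5 / 2) hw
  have h3 := re_riemannZeta_five_halves_bounds.2
  linarith [exp_L52_ge]

/-- Region `2 ≤ σ`: `|ζ(σ+it)| ≤ ζ(2) = π²/6 ≤ e^{0.4978}`. [folklore] -/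
theorem norm_riemannZeta_le_exp_of_two_le {w : ℂ} (hw : 2 ≤ w.re) :
    ‖riemannZeta w‖ ≤ Real.exp 0.4978 := by
  have h1 := norm_riemannZeta_le_re_riemannZeta (s := w) (by linarith)
  have h2 := re_riemannZeta_ofReal_antitone (by norm_num : (1 : ℝ) < 2) hw
  rw [re_riemannZeta_two] at h2
  linarith [pi_sq_div_six_le_exp]

/-- Region `5/4 ≤ σ ≤ 2`: the chord of the convex `log ζ(σ)` through `σ = 5/4` and `σ = 2`:
`|ζ(σ+it)| ≤ exp(1.533 + (σ - 5/4)(4/3)(0.4978 - 1.533))`. [folklore] -/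
theorem norm_riemannZeta_le_exp_chord {w : ℂ} (h1 : 5 / 4 ≤ w.re) (h2 : w.re ≤ 2) :
    ‖riemannZeta w‖ ≤ Real.exp (1.533 + (w.re - 5 / 4) * (4 / 3) * (0.4978 - 1.533)) := by
  set σ := w.re with hσ
  have hσ1 : 1 < σ := by linarith
  have hle := norm_riemannZeta_le_re_riemannZeta (s := w) hσ1
  have hpos : 0 < (riemannZeta (σ : ℂ)).re := lt_of_lt_of_le one_pos (one_le_re_riemannZeta_ofReal hσ1)
  set b := (σ - 5 / 4) * (4 / 3) with hb
  have hb0 : 0 ≤ b := by rw [hb]; nlinarith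
  have hb1 : b ≤ 1 := by rw [hb]; nlinarith
  have hconv := convexOn_log_re_riemannZeta.2 (show (5 / 4 : ℝ) ∈ Ioi 1 by norm_num)
    (show (2 : ℝ) ∈ Ioi 1 by norm_num) (show 0 ≤ 1 - b by linarith) hb0 (by ring)
  simp only [smul_eq_mul] at hconv
  rw [show (1 - b) * (5 / 4 : ℝ) + b * 2 = σ by rw [hb]; ring] at hconv
  have hZ := log_re_riemannZeta_five_fourths_le
  have hL := log_re_riemannZeta_two_le
  have hlog : Real.log (riemannZeta (σ : ℂ)).re ≤ 1.533 + (σ - 5 / 4) * (4 / 3) * (0.4978 - 1.533) := by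
    calc Real.log (riemannZeta (σ : ℂ)).re
        ≤ (1 - b) * Real.log (riemannZeta ((5 / 4 : ℝ) : ℂ)).re + b * Real.log (riemannZeta ((2 : ℝ) : ℂ)).re :=
          hconv
      _ ≤ (1 - b) * 1.533 + b * 0.4978 := by
          gcongr
      _ = _ := by rw [hb]; ring
  calc ‖riemannZeta w‖ ≤ (riemannZeta (σ : ℂ)).re := hle
    _ = Real.exp (Real.log (riemannZeta (σ : ℂ)).re) := (Real.exp_log hpos).symm
    _ ≤ _ := Real.exp_le_exp.2 hlog

/-- The all-`t` critical-line input with `K = 2.53`, `Q = 5/2`, `θ = 1/4` (Trudgian 2011,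
Lemma 2.5 and its footnote, proved in the tree). [cite: Trudgian2011, Lemma 2.5] -/
lemma hline (u : ℝ) : ‖riemannZeta (1 / 2 + u * I)‖ ≤
    2.53 * ‖((5 / 2 : ℝ) : ℂ) + (1 / 2 + u * I)‖ ^ (1 / 4 : ℝ) :=
  norm_riemannZeta_half_line_le_allT Trudgian2011_lemma_2_5_allT_holds u

/-- Region `1/2 ≤ σ ≤ 5/4`, `|t - T| ≤ 3/2`, `T ≥ 30` (Rademacher–Trudgian convexity bound from
`|ζ(½+it)| ≤ 2.53|3+it|^{1/4}` and `ζ(5/4)`, in exponential form): with `a = (5/4 - σ)/(3/4)`,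
`|ζ(σ+it)| ≤ exp(0.9283 a + 1.533 (1 - a) + (a/4)(log T + 0.058) + 0.009)`.
[cite: Trudgian2011, Lemma 2.7] [cite: Rademacher1959, Thm 2] -/
theorem norm_riemannZeta_le_exp_f₂ {T : ℝ} (hT : 30 ≤ T) {w : ℂ} (h1 : 1 / 2 ≤ w.re)
    (h2 : w.re ≤ 5 / 4) (ht1 : T - 3 / 2 ≤ w.im) (ht2 : w.im ≤ T + 3 / 2) :
    ‖riemannZeta w‖ ≤ Real.exp ((5 / 4 - w.re) / (3 / 4) * 0.9283 + (1 - (5 / 4 - w.re) / (3 / 4)) * 1.533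
      + (5 / 4 - w.re) / (3 / 4) / 4 * (Real.log T + 0.058) + 0.009) := by
  set σ := w.re with hσ
  set t := w.im with ht
  set a := (5 / 4 - σ) / (3 / 4) with ha
  have ha0 : 0 ≤ a := by rw [ha]; apply div_nonneg <;> linarith
  have ha1 : a ≤ 1 := by rw [ha, div_le_one (by norm_num)]; linarith
  have htpos : 0 < t := by linarith
  have hw1 : w ≠ 1 := fun h ↦ by
    have := congrArg Complex.im h; rw [← ht] at this; simp at this; linarith
  have hw : w = (σ : ℂ) + t * I := (Complex.re_add_im w).symm
  have h := norm_riemannZeta_le_convexity (K := 2.53) (θ := 1 / 4) (Q := 5 / 2) (c := 5 / 4)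
    (by norm_num) (by norm_num) (by norm_num) (by norm_num) hline h1 h2 hw1
  rw [← hσ] at h
  have e1 : (5 / 4 - σ) / (5 / 4 - 1 / 2) = a := by rw [ha]; norm_num
  have e2 : (σ - 1 / 2) / (5 / 4 - 1 / 2) = 1 - a := by rw [ha]; field_simp; ring
  rw [e1, e2] at h
  set N := ‖((5 / 2 : ℝ) : ℂ) + w‖ with hN
  set M := ‖w - 1‖ with hM
  have hN2 : N ^ 2 = (5 / 2 + σ) ^ 2 + t ^ 2 := by
    rw [hN, hw, Complex.sq_norm, Complex.normSq_apply]; simp; ring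
  have hM2 : M ^ 2 = (σ - 1) ^ 2 + t ^ 2 := by
    rw [hM, hw, Complex.sq_norm, Complex.normSq_apply]; simp; ring
  have hNpos : 0 < N := by
    rw [hN, norm_pos_iff]; intro h0
    have := congrArg Complex.im h0; rw [hw] at this; simp at this; linarith
  have hMpos : 0 < M := by rw [hM]; exact norm_pos_iff.2 (sub_ne_zero.2 hw1)
  have hZpos : 0 < (riemannZeta ((5 / 4 : ℝ) : ℂ)).re :=
    lt_of_lt_of_le one_pos (one_le_re_riemannZeta_ofReal (by norm_num))
  -- the four factors
  have b1 : (2.53 : ℝ) ^ a ≤ Real.exp (0.9283 * a) := by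
    rw [Real.rpow_def_of_pos (by norm_num : (0 : ℝ) < 2.53), Real.exp_le_exp]
    exact mul_le_mul_of_nonneg_right log_K_le ha0
  have b2 : (riemannZeta ((5 / 4 : ℝ) : ℂ)).re ^ (1 - a) ≤ Real.exp (1.533 * (1 - a)) := by
    rw [Real.rpow_def_of_pos hZpos, Real.exp_le_exp]
    exact mul_le_mul_of_nonneg_right log_re_riemannZeta_five_fourths_le (by linarith)
  have hlogN : Real.log N ≤ Real.log T + 0.058 := by
    have hE : (1.122728 : ℝ) ≤ Real.exp 0.116 := by
      have := Real.quadratic_le_exp_of_nonneg (show (0 : ℝ) ≤ 0.116 by norm_num)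
      norm_num at this; linarith
    have hN2le : N ^ 2 ≤ (T * Real.exp 0.058) ^ 2 := by
      rw [hN2, mul_pow, ← Real.exp_nat_mul]
      norm_num
      have h3 : (5 / 2 + σ) ^ 2 ≤ (15 / 4) ^ 2 := by
        apply pow_le_pow_left₀ (by linarith) (by linarith)
      have h4 : t ^ 2 ≤ (T + 3 / 2) ^ 2 := by
        apply pow_le_pow_left₀ htpos.le ht2
      nlinarith [mul_le_mul_of_nonneg_left hE (sq_nonneg T)]
    have hNle : N ≤ T * Real.exp 0.058 :=
      (pow_le_pow_iff_left₀ hNpos.le (by positivity) two_ne_zero).1 hN2le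
    calc Real.log N ≤ Real.log (T * Real.exp 0.058) := Real.log_le_log hNpos hNle
      _ = Real.log T + 0.058 := by rw [Real.log_mul (by positivity) (Real.exp_pos _).ne', Real.log_exp]
  have b3 : N ^ (1 / 4 * a) ≤ Real.exp ((Real.log T + 0.058) * (1 / 4 * a)) := by
    rw [Real.rpow_def_of_pos hNpos, Real.exp_le_exp]
    exact mul_le_mul_of_nonneg_right hlogN (by positivity)
  have b4 : N / M ≤ Real.exp 0.009 := by
    rw [div_le_iff₀ hMpos]
    have hE : (1.018 : ℝ) ≤ Real.exp 0.018 := by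
      have := Real.add_one_le_exp (0.018 : ℝ); norm_num at this; linarith
    have hN2le : N ^ 2 ≤ (Real.exp 0.009 * M) ^ 2 := by
      rw [hN2, mul_pow, ← Real.exp_nat_mul, hM2]
      norm_num
      have h3 : (5 / 2 + σ) ^ 2 ≤ (15 / 4) ^ 2 := by
        apply pow_le_pow_left₀ (by linarith) (by linarith)
      have h4 : (57 / 2 : ℝ) ^ 2 ≤ t ^ 2 := by
        apply pow_le_pow_left₀ (by norm_num) (by linarith)
      nlinarith [mul_le_mul_of_nonneg_left hE (sq_nonneg t), sq_nonneg (σ - 1),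
        mul_nonneg (show (0:ℝ) ≤ 1.018 by norm_num) (sq_nonneg (σ - 1))]
    exact (pow_le_pow_iff_left₀ hNpos.le (by positivity) two_ne_zero).1 hN2le
  calc ‖riemannZeta w‖ ≤ 2.53 ^ a * (riemannZeta ((5 / 4 : ℝ) : ℂ)).re ^ (1 - a) *
        N ^ (1 / 4 * a) * (N / M) := h
    _ ≤ Real.exp (0.9283 * a) * Real.exp (1.533 * (1 - a)) *
        Real.exp ((Real.log T + 0.058) * (1 / 4 * a)) * Real.exp 0.009 := by
        gcongr
    _ = _ := by
        rw [← Real.exp_add, ← Real.exp_add, ← Real.exp_add]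
        congr 1
        rw [ha]
        ring

/-- Region `-1/4 ≤ σ ≤ 1/2`, `|t - T| ≤ 3/2`, `T ≥ 30` (functional equation with the factor
`e^{1/2}(|t|/2π)^{1/2-σ}`, then the previous region at `1 - σ`): with `a' = (1/4 + σ)/(3/4)`,
`|ζ(σ+it)| ≤ exp(1/2 + (1/2-σ)(log T - 1.788) + 0.9283 a' + 1.533(1-a') + (a'/4)(log T + 0.058) + 0.009)`.
[cite: Titchmarsh1986, §4.12 (4.12.3)] [cite: Trudgian2011, Lemma 2.7] -/
theorem norm_riemannZeta_le_exp_f₃ {T : ℝ} (hT : 30 ≤ T) {w : ℂ} (h1 : -1 / 4 ≤ w.re)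
    (h2 : w.re ≤ 1 / 2) (ht1 : T - 3 / 2 ≤ w.im) (ht2 : w.im ≤ T + 3 / 2) :
    ‖riemannZeta w‖ ≤ Real.exp (1 / 2 + (1 / 2 - w.re) * (Real.log T - 1.788) +
      ((5 / 4 - (1 - w.re)) / (3 / 4) * 0.9283 + (1 - (5 / 4 - (1 - w.re)) / (3 / 4)) * 1.533
      + (5 / 4 - (1 - w.re)) / (3 / 4) / 4 * (Real.log T + 0.058) + 0.009)) := by
  set σ := w.re with hσ
  set t := w.im with ht
  have htpos : 0 < t := by linarith
  have hT0 : 0 < T := by linarith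
  have hw : w = (σ : ℂ) + t * I := (Complex.re_add_im w).symm
  have htabs : |t| = t := abs_of_pos htpos
  have hfe := norm_riemannZeta_le_fe (σ := σ) (t := t) (by linarith) h2 (by rw [htabs]; linarith)
  rw [← hw, htabs] at hfe
  -- the power of `t/2π`
  have hpow : (t / (2 * π)) ^ (1 / 2 - σ) ≤ Real.exp ((1 / 2 - σ) * (Real.log T - 1.788)) := by
    have hq : 0 < t / (2 * π) := by positivity
    rw [Real.rpow_def_of_pos hq, Real.exp_le_exp, mul_comm]
    refine mul_le_mul_of_nonneg_left ?_ (by linarith)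
    have hE := exp_mul_le_two_pi
    have hle : t / (2 * π) ≤ T * Real.exp (-1.788) := by
      rw [div_le_iff₀ (by positivity), Real.exp_neg]
      have hEpos : 0 < Real.exp 1.788 := Real.exp_pos _
      rw [show T * (Real.exp 1.788)⁻¹ * (2 * π) = T * (2 * π) / Real.exp 1.788 by ring,
        le_div_iff₀ hEpos]
      nlinarith
    calc Real.log (t / (2 * π)) ≤ Real.log (T * Real.exp (-1.788)) := Real.log_le_log hq hle
      _ = Real.log T - 1.788 := by
          rw [Real.log_mul hT0.ne' (Real.exp_pos _).ne', Real.log_exp]; ring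
  -- the previous region at `1 - σ + it`
  set w₁ : ℂ := 1 - (σ : ℂ) + t * I with hw₁
  have hw₁re : w₁.re = 1 - σ := by simp [hw₁]
  have hw₁im : w₁.im = t := by simp [hw₁]
  have hf₂ := norm_riemannZeta_le_exp_f₂ hT (w := w₁) (by rw [hw₁re]; linarith) (by rw [hw₁re]; linarith)
    (by rw [hw₁im]; exact ht1) (by rw [hw₁im]; exact ht2)
  rw [hw₁re] at hf₂
  calc ‖riemannZeta w‖ ≤ Real.exp (1 / 2) * (t / (2 * π)) ^ (1 / 2 - σ) * ‖riemannZeta w₁‖ := hfe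
    _ ≤ Real.exp (1 / 2) * Real.exp ((1 / 2 - σ) * (Real.log T - 1.788)) *
        Real.exp ((5 / 4 - (1 - σ)) / (3 / 4) * 0.9283 + (1 - (5 / 4 - (1 - σ)) / (3 / 4)) * 1.533
          + (5 / 4 - (1 - σ)) / (3 / 4) / 4 * (Real.log T + 0.058) + 0.009) := by
        gcongr
    _ = _ := by rw [← Real.exp_add, ← Real.exp_add]

/-! ### Bookkeeping on the circle -/

/-- Half-circle reduction needing integrability on `[0, π]` only (the integrand is symmetric under
`θ ↦ 2π - θ`). [folklore] -/
theorem circleAverage_re_eq' {b : ℝ → ℝ} {c R : ℝ}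
    (hb : IntervalIntegrable (fun θ ↦ b (c + R * Real.cos θ)) volume 0 π) :
    Real.circleAverage (fun z ↦ b z.re) c R = π⁻¹ * ∫ θ in (0 : ℝ)..π, b (c + R * Real.cos θ) := by
  have hsymm : (fun x ↦ b (c + R * Real.cos (2 * π - x))) = fun x ↦ b (c + R * Real.cos x) := by
    funext x; rw [Real.cos_two_pi_sub]
  have hb2 : IntervalIntegrable (fun θ ↦ b (c + R * Real.cos θ)) volume π (2 * π) := by
    have h := hb.comp_sub_left (2 * π)
    rw [hsymm, show 2 * π - 0 = 2 * π by ring, show 2 * π - π = π by ring] at h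
    exact h.symm
  rw [Real.circleAverage_def, smul_eq_mul]
  simp_rw [Literature.Analysis.Complex.circleMap_ofReal_re]
  have hsplit := intervalIntegral.integral_add_adjacent_intervals hb hb2
  have hsecond : (∫ θ in π..2 * π, b (c + R * Real.cos θ)) = ∫ θ in (0 : ℝ)..π, b (c + R * Real.cos θ) := by
    have h := intervalIntegral.integral_comp_sub_left (fun θ ↦ b (c + R * Real.cos θ)) (2 * π)
      (a := 0) (b := π)
    simp only [Real.cos_two_pi_sub] at h
    rw [show 2 * π - π = π by ring, sub_zero] at h
    exact h.symm
  rw [← hsplit, hsecond, ← two_mul, mul_inv, mul_assoc, ← mul_assoc π⁻¹, mul_comm π⁻¹ 2]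
  have hπ : (π : ℝ) ≠ 0 := Real.pi_ne_zero
  field_simp

/-- Trigonometric values at the arc endpoints. [folklore] -/
lemma cos_two_pi_div_three : Real.cos (2 * π / 3) = -(1 / 2) := by
  rw [show 2 * π / 3 = π - π / 3 by ring, Real.cos_pi_sub, Real.cos_pi_div_three]

/-- `sin(2π/3) = √3/2`. [folklore] -/
lemma sin_two_pi_div_three : Real.sin (2 * π / 3) = Real.sqrt 3 / 2 := by
  rw [show 2 * π / 3 = π - π / 3 by ring, Real.sin_pi_sub, Real.sin_pi_div_three]

/-- **The final numerical inequality**: with `I(ℓ)` the exact value of the arc integrals,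
`0.71/π + (I(ℓ)/π + 1.247)/log 2 ≤ 0.3083 ℓ + 3.24` for `ℓ ≥ 3.401`. [folklore] -/
lemma final_numeric {ℓ : ℝ} (hℓ : 3.401 ≤ ℓ) :
    0.71 / π + (π⁻¹ * (0.3043 * (π / 6 - 0) + 0 * (Real.sin (π / 6) - Real.sin 0)
      + (0.4978 * (π / 3 - π / 6) + 0 * (Real.sin (π / 3) - Real.sin (π / 6)))
      + (1.533 * (π / 2 - π / 3) + 2 * (0.4978 - 1.533) * (Real.sin (π / 2) - Real.sin (π / 3)))
      + (1.542 * (2 * π / 3 - π / 2) + (1.1804 - ℓ / 2) * (Real.sin (2 * π / 3) - Real.sin (π / 2)))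
      + ((2.2026 - ℓ / 4) * (π - 2 * π / 3) + (1.5016 - ℓ) * (Real.sin π - Real.sin (2 * π / 3))))
      + 1.247) / Real.log 2 ≤ 0.3083 * ℓ + 3.24 := by
  rw [Real.sin_pi_div_six, Real.sin_zero, Real.sin_pi_div_three, Real.sin_pi_div_two, sin_two_pi_div_three,
    Real.sin_pi]
  obtain ⟨hs1, hs2⟩ := sqrt_three_bounds
  have hπ1 := Real.pi_gt_d6
  have hπ2 := Real.pi_lt_d6
  have hl1 := Real.log_two_gt_d9
  have hπ0 : 0 < π := Real.pi_pos
  have hℓ0 : 0 ≤ ℓ := by linarith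
  -- the bracket not multiplied by `π`
  set J := Real.sqrt 3 * (0.8746 + ℓ / 4) - 3.2508 + ℓ / 2 with hJ
  have hI : 0.3043 * (π / 6 - 0) + 0 * (1 / 2 - 0)
      + (0.4978 * (π / 3 - π / 6) + 0 * (Real.sqrt 3 / 2 - 1 / 2))
      + (1.533 * (π / 2 - π / 3) + 2 * (0.4978 - 1.533) * (1 - Real.sqrt 3 / 2))
      + (1.542 * (2 * π / 3 - π / 2) + (1.1804 - ℓ / 2) * (Real.sqrt 3 / 2 - 1))
      + ((2.2026 - ℓ / 4) * (π - 2 * π / 3) + (1.5016 - ℓ) * (0 - Real.sqrt 3 / 2))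
      = π * (0.3043 / 6 + 0.4978 / 6 + 1.533 / 6 + 1.542 / 6 + 2.2026 / 3 - ℓ / 12) + J := by
    rw [hJ]; ring
  rw [hI]
  have hJup : J ≤ -1.735948 + 0.93301273 * ℓ := by
    rw [hJ]
    have := mul_le_mul_of_nonneg_right hs2.le (show (0 : ℝ) ≤ 0.8746 + ℓ / 4 by linarith)
    nlinarith
  have hJpos : 0 ≤ J := by
    rw [hJ]
    have := mul_le_mul_of_nonneg_right hs1.le (show (0 : ℝ) ≤ 0.8746 + ℓ / 4 by linarith)
    nlinarith
  have hA : π⁻¹ * (π * (0.3043 / 6 + 0.4978 / 6 + 1.533 / 6 + 1.542 / 6 + 2.2026 / 3 - ℓ / 12) + J) =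
      (0.3043 / 6 + 0.4978 / 6 + 1.533 / 6 + 1.542 / 6 + 2.2026 / 3 - ℓ / 12) + J / π := by
    field_simp
  rw [hA]
  have hJπ : J / π ≤ (-1.735948 + 0.93301273 * ℓ) / 3.141592 := by
    calc J / π ≤ J / 3.141592 := div_le_div_of_nonneg_left hJpos (by norm_num) hπ1.le
      _ ≤ _ := div_le_div_of_nonneg_right hJup (by norm_num)
  have h1 : 0.71 / π ≤ 0.71 / 3.141592 := div_le_div_of_nonneg_left (by norm_num) (by norm_num) hπ1.le
  have hJlo : 1.7320508 * (0.8746 + ℓ / 4) - 3.2508 + ℓ / 2 ≤ J := by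
    rw [hJ]
    have := mul_le_mul_of_nonneg_right hs1.le (show (0 : ℝ) ≤ 0.8746 + ℓ / 4 by linarith)
    linarith
  have hJlo0 : (0 : ℝ) ≤ 1.7320508 * (0.8746 + ℓ / 4) - 3.2508 + ℓ / 2 := by linarith
  have hJπlo : (1.7320508 * (0.8746 + ℓ / 4) - 3.2508 + ℓ / 2) / 3.141593 ≤ J / π :=
    calc (1.7320508 * (0.8746 + ℓ / 4) - 3.2508 + ℓ / 2) / 3.141593
        ≤ (1.7320508 * (0.8746 + ℓ / 4) - 3.2508 + ℓ / 2) / π :=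
          div_le_div_of_nonneg_left hJlo0 hπ0 hπ2.le
      _ ≤ J / π := div_le_div_of_nonneg_right hJlo hπ0.le
  have hnum : 0 ≤ (0.3043 / 6 + 0.4978 / 6 + 1.533 / 6 + 1.542 / 6 + 2.2026 / 3 - ℓ / 12) + J / π + 1.247 := by
    have h := hJπlo
    norm_num at h ⊢
    linarith
  have h2 : ((0.3043 / 6 + 0.4978 / 6 + 1.533 / 6 + 1.542 / 6 + 2.2026 / 3 - ℓ / 12) + J / π + 1.247) / Real.log 2
      ≤ ((0.3043 / 6 + 0.4978 / 6 + 1.533 / 6 + 1.542 / 6 + 2.2026 / 3 - ℓ / 12)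
          + (-1.735948 + 0.93301273 * ℓ) / 3.141592 + 1.247) / 0.6931471803 := by
    calc _ ≤ ((0.3043 / 6 + 0.4978 / 6 + 1.533 / 6 + 1.542 / 6 + 2.2026 / 3 - ℓ / 12) + J / π + 1.247) / 0.6931471803 :=
          div_le_div_of_nonneg_left hnum (by norm_num) hl1.le
      _ ≤ _ := by
          apply div_le_div_of_nonneg_right _ (by norm_num)
          linarith
  have h3 : 0.71 / 3.141592 + ((0.3043 / 6 + 0.4978 / 6 + 1.533 / 6 + 1.542 / 6 + 2.2026 / 3 - ℓ / 12)
      + (-1.735948 + 0.93301273 * ℓ) / 3.141592 + 1.247) / 0.6931471803 ≤ 0.3083 * ℓ + 3.24 := by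
    norm_num
    linarith
  have h4 := add_le_add h1 h2
  norm_num at h3 h4 ⊢
  linarith

/-- One arc: if `F ≤ p + q cos` on `(a, b)` and `F` is integrable on `[a, b]` then
`∫_a^b F ≤ p (b - a) + q (sin b - sin a)`. [folklore] -/
lemma integral_le_affine_cos {F : ℝ → ℝ} {a b p q : ℝ} (hab : a ≤ b)
    (hF : IntervalIntegrable F volume a b) (hle : ∀ x ∈ Ioo a b, F x ≤ p + q * Real.cos x) :
    ∫ x in a..b, F x ≤ p * (b - a) + q * (Real.sin b - Real.sin a) := by
  have hint2 : IntervalIntegrable (fun x ↦ p + q * Real.cos x) volume a b :=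
    (continuous_const.add (continuous_const.mul Real.continuous_cos)).intervalIntegrable _ _
  calc ∫ x in a..b, F x ≤ ∫ x in a..b, (p + q * Real.cos x) :=
        intervalIntegral.integral_mono_on_of_le_Ioo hab hF hint2 hle
    _ = p * (b - a) + q * (Real.sin b - Real.sin a) := by
        rw [intervalIntegral.integral_add intervalIntegrable_const
            (Real.continuous_cos.intervalIntegrable _ _ |>.const_mul _),
          intervalIntegral.integral_const, intervalIntegral.integral_const_mul, integral_cos]
        simp [smul_eq_mul, mul_comm]

/-! ### The majorant `exp F(σ)` on the circle `|s - (5/4 + iT)| = 3/2` -/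

/-! The majorant.  To stay definition-free the piecewise-affine logarithm of the majorant is a
*variable* `Fm : ℝ → ℝ → ℝ` together with the hypothesis `hF : Fm = (fun ℓ σ ↦ …)` spelling it out:
`Fm ℓ σ` (`ℓ = log T`) is the functional-equation piece on `σ < 1/2`, the logarithm of the convexity
bound on `1/2 ≤ σ < 5/4`, the chord of `log ζ(σ)` on `5/4 ≤ σ < 2`, `log ζ(2) ≤ 0.4978` on
`2 ≤ σ < 5/4 + 3√3/4` and `log ζ(5/2) ≤ 0.3043` beyond; the pieces change at the abscissae of the
circle `|s − 5/4| = 3/2` at the angles `2π/3, π/2, π/3, π/6`. -/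

/-- `σs ≥ 5/2` (`√3 ≥ 5/3`). [folklore] -/
lemma five_halves_le_σs : (5 / 2 : ℝ) ≤ 5 / 4 + 3 / 2 * (Real.sqrt 3 / 2) := by
  have := sqrt_three_bounds.1; linarith

/-- `F ≥ 0` for `σ ≥ -1/4` when `ℓ ≥ 3.401`. [folklore] -/
lemma F_nonneg {Fm : ℝ → ℝ → ℝ}
    (hF : Fm = (fun (ℓ σ : ℝ) ↦
      if σ < 1 / 2 then 1 / 2 + (1 / 2 - σ) * (ℓ - 1.788)
        + ((5 / 4 - (1 - σ)) / (3 / 4) * 0.9283 + (1 - (5 / 4 - (1 - σ)) / (3 / 4)) * 1.533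
          + (5 / 4 - (1 - σ)) / (3 / 4) / 4 * (ℓ + 0.058) + 0.009)
      else if σ < 5 / 4 then (5 / 4 - σ) / (3 / 4) * 0.9283 + (1 - (5 / 4 - σ) / (3 / 4)) * 1.533
          + (5 / 4 - σ) / (3 / 4) / 4 * (ℓ + 0.058) + 0.009
      else if σ < 2 then 1.533 + (σ - 5 / 4) * (4 / 3) * (0.4978 - 1.533)
      else if σ < 5 / 4 + 3 / 2 * (Real.sqrt 3 / 2) then 0.4978 else 0.3043))
    {ℓ σ : ℝ} (hℓ : 3.401 ≤ ℓ) (hσ : -1 / 4 ≤ σ) : 0 ≤ Fm ℓ σ := by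
  subst hF
  dsimp only
  by_cases c1 : σ < 1 / 2
  · rw [if_pos c1]
    have p1 : 0 ≤ (1 / 2 - σ) * (ℓ - 1.788) := mul_nonneg (by linarith) (by linarith)
    have p2 : 0 ≤ (5 / 4 - (1 - σ)) * (ℓ + 0.058) := mul_nonneg (by linarith) (by linarith)
    nlinarith
  rw [if_neg c1]
  by_cases c2 : σ < 5 / 4
  · rw [if_pos c2]
    have p2 : 0 ≤ (5 / 4 - σ) * (ℓ + 0.058) := mul_nonneg (by linarith) (by linarith)
    nlinarith
  rw [if_neg c2]
  by_cases c3 : σ < 2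
  · rw [if_pos c3]
    nlinarith
  rw [if_neg c3]
  by_cases c4 : σ < 5 / 4 + 3 / 2 * (Real.sqrt 3 / 2)
  · rw [if_pos c4]; norm_num
  · rw [if_neg c4]; norm_num

/-- **`exp F(log T, σ)` majorises `|ζ(σ+it)|`** for `σ ≥ -1/4`, `|t - T| ≤ 3/2`, `T ≥ 30`
(the five regions). [folklore] -/
theorem norm_riemannZeta_le_exp_F {Fm : ℝ → ℝ → ℝ}
    (hF : Fm = (fun (ℓ σ : ℝ) ↦
      if σ < 1 / 2 then 1 / 2 + (1 / 2 - σ) * (ℓ - 1.788)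
        + ((5 / 4 - (1 - σ)) / (3 / 4) * 0.9283 + (1 - (5 / 4 - (1 - σ)) / (3 / 4)) * 1.533
          + (5 / 4 - (1 - σ)) / (3 / 4) / 4 * (ℓ + 0.058) + 0.009)
      else if σ < 5 / 4 then (5 / 4 - σ) / (3 / 4) * 0.9283 + (1 - (5 / 4 - σ) / (3 / 4)) * 1.533
          + (5 / 4 - σ) / (3 / 4) / 4 * (ℓ + 0.058) + 0.009
      else if σ < 2 then 1.533 + (σ - 5 / 4) * (4 / 3) * (0.4978 - 1.533)
      else if σ < 5 / 4 + 3 / 2 * (Real.sqrt 3 / 2) then 0.4978 else 0.3043))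
    {T : ℝ} (hT : 30 ≤ T) {w : ℂ} (hr1 : -1 / 4 ≤ w.re)
    (hi1 : T - 3 / 2 ≤ w.im) (hi2 : w.im ≤ T + 3 / 2) :
    ‖riemannZeta w‖ ≤ Real.exp (Fm (Real.log T) w.re) := by
  subst hF
  dsimp only
  by_cases c1 : w.re < 1 / 2
  · rw [if_pos c1]
    exact norm_riemannZeta_le_exp_f₃ hT hr1 c1.le hi1 hi2
  rw [if_neg c1]
  by_cases c2 : w.re < 5 / 4
  · rw [if_pos c2]
    exact norm_riemannZeta_le_exp_f₂ hT (not_lt.1 c1) c2.le hi1 hi2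
  rw [if_neg c2]
  by_cases c3 : w.re < 2
  · rw [if_pos c3]
    exact norm_riemannZeta_le_exp_chord (not_lt.1 c2) c3.le
  rw [if_neg c3]
  by_cases c4 : w.re < 5 / 4 + 3 / 2 * (Real.sqrt 3 / 2)
  · rw [if_pos c4]; exact norm_riemannZeta_le_exp_of_two_le (not_lt.1 c3)
  · rw [if_neg c4]
    exact norm_riemannZeta_le_exp_of_five_halves_le (five_halves_le_σs.trans (not_lt.1 c4))

/-! ### The five arcs -/

/-- Arc `[0, π/6]`: the constant `0.3043`. [folklore] -/
lemma F_arc₀ {Fm : ℝ → ℝ → ℝ}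
    (hF : Fm = (fun (ℓ σ : ℝ) ↦
      if σ < 1 / 2 then 1 / 2 + (1 / 2 - σ) * (ℓ - 1.788)
        + ((5 / 4 - (1 - σ)) / (3 / 4) * 0.9283 + (1 - (5 / 4 - (1 - σ)) / (3 / 4)) * 1.533
          + (5 / 4 - (1 - σ)) / (3 / 4) / 4 * (ℓ + 0.058) + 0.009)
      else if σ < 5 / 4 then (5 / 4 - σ) / (3 / 4) * 0.9283 + (1 - (5 / 4 - σ) / (3 / 4)) * 1.533
          + (5 / 4 - σ) / (3 / 4) / 4 * (ℓ + 0.058) + 0.009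
      else if σ < 2 then 1.533 + (σ - 5 / 4) * (4 / 3) * (0.4978 - 1.533)
      else if σ < 5 / 4 + 3 / 2 * (Real.sqrt 3 / 2) then 0.4978 else 0.3043))
    (ℓ : ℝ) {x : ℝ} (hx : x ∈ Icc 0 (π / 6)) : Fm ℓ (5 / 4 + 3 / 2 * Real.cos x) = 0.3043 := by
  subst hF
  have hπ := Real.pi_pos
  have hc : Real.sqrt 3 / 2 ≤ Real.cos x := by
    rw [← Real.cos_pi_div_six]; exact Real.cos_le_cos_of_nonneg_of_le_pi hx.1 (by linarith) hx.2
  have hs := sqrt_three_bounds.1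
  have hσ : 5 / 4 + 3 / 2 * (Real.sqrt 3 / 2) ≤ 5 / 4 + 3 / 2 * Real.cos x := by linarith
  have n1 : ¬ 5 / 4 + 3 / 2 * Real.cos x < 1 / 2 := by linarith
  have n2 : ¬ 5 / 4 + 3 / 2 * Real.cos x < 5 / 4 := by linarith
  have n3 : ¬ 5 / 4 + 3 / 2 * Real.cos x < 2 := by linarith
  dsimp only
  rw [if_neg n1, if_neg n2, if_neg n3, if_neg (not_lt.2 hσ)]

/-- Arc `(π/6, π/3]`: the constant `0.4978`. [folklore] -/
lemma F_arc₁ {Fm : ℝ → ℝ → ℝ}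
    (hF : Fm = (fun (ℓ σ : ℝ) ↦
      if σ < 1 / 2 then 1 / 2 + (1 / 2 - σ) * (ℓ - 1.788)
        + ((5 / 4 - (1 - σ)) / (3 / 4) * 0.9283 + (1 - (5 / 4 - (1 - σ)) / (3 / 4)) * 1.533
          + (5 / 4 - (1 - σ)) / (3 / 4) / 4 * (ℓ + 0.058) + 0.009)
      else if σ < 5 / 4 then (5 / 4 - σ) / (3 / 4) * 0.9283 + (1 - (5 / 4 - σ) / (3 / 4)) * 1.533
          + (5 / 4 - σ) / (3 / 4) / 4 * (ℓ + 0.058) + 0.009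
      else if σ < 2 then 1.533 + (σ - 5 / 4) * (4 / 3) * (0.4978 - 1.533)
      else if σ < 5 / 4 + 3 / 2 * (Real.sqrt 3 / 2) then 0.4978 else 0.3043))
    (ℓ : ℝ) {x : ℝ} (hx : x ∈ Ioc (π / 6) (π / 3)) : Fm ℓ (5 / 4 + 3 / 2 * Real.cos x) = 0.4978 := by
  subst hF
  have hπ := Real.pi_pos
  have hx0 : 0 ≤ x := by linarith [hx.1]
  have hxπ : x ≤ π := by linarith [hx.2]
  have hc1 : Real.cos x < Real.sqrt 3 / 2 := by
    rw [← Real.cos_pi_div_six]; exact Real.cos_lt_cos_of_nonneg_of_le_pi (by linarith) hxπ hx.1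
  have hc2 : 1 / 2 ≤ Real.cos x := by
    rw [← Real.cos_pi_div_three]; exact Real.cos_le_cos_of_nonneg_of_le_pi hx0 (by linarith) hx.2
  have hσ : 5 / 4 + 3 / 2 * Real.cos x < 5 / 4 + 3 / 2 * (Real.sqrt 3 / 2) := by linarith
  have n1 : ¬ 5 / 4 + 3 / 2 * Real.cos x < 1 / 2 := by linarith
  have n2 : ¬ 5 / 4 + 3 / 2 * Real.cos x < 5 / 4 := by linarith
  have n3 : ¬ 5 / 4 + 3 / 2 * Real.cos x < 2 := by linarith
  dsimp only
  rw [if_neg n1, if_neg n2, if_neg n3, if_pos hσ]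

/-- Arc `(π/3, π/2]`: the chord. [folklore] -/
lemma F_arc₂ {Fm : ℝ → ℝ → ℝ}
    (hF : Fm = (fun (ℓ σ : ℝ) ↦
      if σ < 1 / 2 then 1 / 2 + (1 / 2 - σ) * (ℓ - 1.788)
        + ((5 / 4 - (1 - σ)) / (3 / 4) * 0.9283 + (1 - (5 / 4 - (1 - σ)) / (3 / 4)) * 1.533
          + (5 / 4 - (1 - σ)) / (3 / 4) / 4 * (ℓ + 0.058) + 0.009)
      else if σ < 5 / 4 then (5 / 4 - σ) / (3 / 4) * 0.9283 + (1 - (5 / 4 - σ) / (3 / 4)) * 1.533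
          + (5 / 4 - σ) / (3 / 4) / 4 * (ℓ + 0.058) + 0.009
      else if σ < 2 then 1.533 + (σ - 5 / 4) * (4 / 3) * (0.4978 - 1.533)
      else if σ < 5 / 4 + 3 / 2 * (Real.sqrt 3 / 2) then 0.4978 else 0.3043))
    (ℓ : ℝ) {x : ℝ} (hx : x ∈ Ioc (π / 3) (π / 2)) :
    Fm ℓ (5 / 4 + 3 / 2 * Real.cos x) = 1.533 + 2 * (0.4978 - 1.533) * Real.cos x := by
  subst hF
  have hπ := Real.pi_pos
  have hx0 : 0 ≤ x := by linarith [hx.1]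
  have hxπ : x ≤ π := by linarith [hx.2]
  have hc1 : Real.cos x < 1 / 2 := by
    rw [← Real.cos_pi_div_three]; exact Real.cos_lt_cos_of_nonneg_of_le_pi (by linarith) hxπ hx.1
  have hc2 : 0 ≤ Real.cos x := by
    rw [← Real.cos_pi_div_two]; exact Real.cos_le_cos_of_nonneg_of_le_pi hx0 (by linarith) hx.2
  have n1 : ¬ 5 / 4 + 3 / 2 * Real.cos x < 1 / 2 := by linarith
  have n2 : ¬ 5 / 4 + 3 / 2 * Real.cos x < 5 / 4 := by linarith
  have y3 : 5 / 4 + 3 / 2 * Real.cos x < 2 := by linarith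
  dsimp only
  rw [if_neg n1, if_neg n2, if_pos y3]
  ring

/-- Arc `(π/2, 2π/3]`: the piece `f₂`. [folklore] -/
lemma F_arc₃ {Fm : ℝ → ℝ → ℝ}
    (hF : Fm = (fun (ℓ σ : ℝ) ↦
      if σ < 1 / 2 then 1 / 2 + (1 / 2 - σ) * (ℓ - 1.788)
        + ((5 / 4 - (1 - σ)) / (3 / 4) * 0.9283 + (1 - (5 / 4 - (1 - σ)) / (3 / 4)) * 1.533
          + (5 / 4 - (1 - σ)) / (3 / 4) / 4 * (ℓ + 0.058) + 0.009)
      else if σ < 5 / 4 then (5 / 4 - σ) / (3 / 4) * 0.9283 + (1 - (5 / 4 - σ) / (3 / 4)) * 1.533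
          + (5 / 4 - σ) / (3 / 4) / 4 * (ℓ + 0.058) + 0.009
      else if σ < 2 then 1.533 + (σ - 5 / 4) * (4 / 3) * (0.4978 - 1.533)
      else if σ < 5 / 4 + 3 / 2 * (Real.sqrt 3 / 2) then 0.4978 else 0.3043))
    (ℓ : ℝ) {x : ℝ} (hx : x ∈ Ioc (π / 2) (2 * π / 3)) :
    Fm ℓ (5 / 4 + 3 / 2 * Real.cos x) = 1.542 + (1.1804 - ℓ / 2) * Real.cos x := by
  subst hF
  have hπ := Real.pi_pos
  have hx0 : 0 ≤ x := by linarith [hx.1]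
  have hxπ : x ≤ π := by linarith [hx.2]
  have hc1 : Real.cos x < 0 := by
    rw [← Real.cos_pi_div_two]; exact Real.cos_lt_cos_of_nonneg_of_le_pi (by linarith) hxπ hx.1
  have hc2 : -(1 / 2) ≤ Real.cos x := by
    rw [← cos_two_pi_div_three]; exact Real.cos_le_cos_of_nonneg_of_le_pi hx0 (by linarith) hx.2
  have n1 : ¬ 5 / 4 + 3 / 2 * Real.cos x < 1 / 2 := by linarith
  have y2 : 5 / 4 + 3 / 2 * Real.cos x < 5 / 4 := by linarith
  dsimp only
  rw [if_neg n1, if_pos y2]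
  ring

/-- Arc `(2π/3, π]`: the piece `f₃`. [folklore] -/
lemma F_arc₄ {Fm : ℝ → ℝ → ℝ}
    (hF : Fm = (fun (ℓ σ : ℝ) ↦
      if σ < 1 / 2 then 1 / 2 + (1 / 2 - σ) * (ℓ - 1.788)
        + ((5 / 4 - (1 - σ)) / (3 / 4) * 0.9283 + (1 - (5 / 4 - (1 - σ)) / (3 / 4)) * 1.533
          + (5 / 4 - (1 - σ)) / (3 / 4) / 4 * (ℓ + 0.058) + 0.009)
      else if σ < 5 / 4 then (5 / 4 - σ) / (3 / 4) * 0.9283 + (1 - (5 / 4 - σ) / (3 / 4)) * 1.533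
          + (5 / 4 - σ) / (3 / 4) / 4 * (ℓ + 0.058) + 0.009
      else if σ < 2 then 1.533 + (σ - 5 / 4) * (4 / 3) * (0.4978 - 1.533)
      else if σ < 5 / 4 + 3 / 2 * (Real.sqrt 3 / 2) then 0.4978 else 0.3043))
    (ℓ : ℝ) {x : ℝ} (hx : x ∈ Ioc (2 * π / 3) π) :
    Fm ℓ (5 / 4 + 3 / 2 * Real.cos x) = (2.2026 - ℓ / 4) + (1.5016 - ℓ) * Real.cos x := by
  subst hF
  have hπ := Real.pi_pos
  have hc1 : Real.cos x < -(1 / 2) := by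
    rw [← cos_two_pi_div_three]; exact Real.cos_lt_cos_of_nonneg_of_le_pi (by linarith) hx.2 hx.1
  have y1 : 5 / 4 + 3 / 2 * Real.cos x < 1 / 2 := by linarith
  dsimp only
  rw [if_pos y1]
  ring

/-- **The integral over the half circle**: `θ ↦ Fm ℓ (5/4 + (3/2)cos θ)` is integrable on
`[0, π]`, and its integral (computed arc by arc, in closed form) is at most a number `X` with
`0.71/π + (X/π + 1.247)/log 2 ≤ 0.3083 ℓ + 3.24` whenever `ℓ ≥ 3.401` (`final_numeric`). [folklore] -/
theorem integral_F_le {Fm : ℝ → ℝ → ℝ}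
    (hF : Fm = (fun (ℓ σ : ℝ) ↦
      if σ < 1 / 2 then 1 / 2 + (1 / 2 - σ) * (ℓ - 1.788)
        + ((5 / 4 - (1 - σ)) / (3 / 4) * 0.9283 + (1 - (5 / 4 - (1 - σ)) / (3 / 4)) * 1.533
          + (5 / 4 - (1 - σ)) / (3 / 4) / 4 * (ℓ + 0.058) + 0.009)
      else if σ < 5 / 4 then (5 / 4 - σ) / (3 / 4) * 0.9283 + (1 - (5 / 4 - σ) / (3 / 4)) * 1.533
          + (5 / 4 - σ) / (3 / 4) / 4 * (ℓ + 0.058) + 0.009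
      else if σ < 2 then 1.533 + (σ - 5 / 4) * (4 / 3) * (0.4978 - 1.533)
      else if σ < 5 / 4 + 3 / 2 * (Real.sqrt 3 / 2) then 0.4978 else 0.3043)) (ℓ : ℝ) :
    IntervalIntegrable (fun θ ↦ Fm ℓ (5 / 4 + 3 / 2 * Real.cos θ)) volume 0 π ∧
      ∃ X : ℝ, ∫ θ in (0 : ℝ)..π, Fm ℓ (5 / 4 + 3 / 2 * Real.cos θ) ≤ X ∧
        (3.401 ≤ ℓ → 0.71 / π + (π⁻¹ * X + 1.247) / Real.log 2 ≤ 0.3083 * ℓ + 3.24) := by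
  have hπ := Real.pi_pos
  set g : ℝ → ℝ := fun θ ↦ Fm ℓ (5 / 4 + 3 / 2 * Real.cos θ) with hg
  have haffint : ∀ (p q a b : ℝ), IntervalIntegrable (fun x ↦ p + q * Real.cos x) volume a b :=
    fun p q a b ↦ (continuous_const.add (continuous_const.mul Real.continuous_cos)).intervalIntegrable _ _
  have hcongr : ∀ {a b : ℝ} (p q : ℝ), a ≤ b → (∀ x ∈ Ioc a b, g x = p + q * Real.cos x) →
      IntervalIntegrable g volume a b := by
    intro a b p q hab hE
    refine (haffint p q a b).congr ?_
    intro x hx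
    rw [Set.uIoc_of_le hab] at hx
    exact (hE x hx).symm
  have h01 : (0 : ℝ) ≤ π / 6 := by positivity
  have h12 : π / 6 ≤ π / 3 := by linarith
  have h23 : π / 3 ≤ π / 2 := by linarith
  have h34 : π / 2 ≤ 2 * π / 3 := by linarith
  have h45 : 2 * π / 3 ≤ π := by linarith
  have hint0 : IntervalIntegrable g volume 0 (π / 6) :=
    hcongr 0.3043 0 h01 (fun x hx ↦ by rw [hg]; dsimp only; rw [F_arc₀ hF ℓ ⟨hx.1.le, hx.2⟩]; ring)
  have hint1 : IntervalIntegrable g volume (π / 6) (π / 3) :=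
    hcongr 0.4978 0 h12 (fun x hx ↦ by rw [hg]; dsimp only; rw [F_arc₁ hF ℓ hx]; ring)
  have hint2 : IntervalIntegrable g volume (π / 3) (π / 2) := hcongr _ _ h23 (fun x hx ↦ F_arc₂ hF ℓ hx)
  have hint3 : IntervalIntegrable g volume (π / 2) (2 * π / 3) := hcongr _ _ h34 (fun x hx ↦ F_arc₃ hF ℓ hx)
  have hint4 : IntervalIntegrable g volume (2 * π / 3) π := hcongr _ _ h45 (fun x hx ↦ F_arc₄ hF ℓ hx)
  have A0 := integral_le_affine_cos (p := 0.3043) (q := 0) h01 hint0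
    (fun x hx ↦ by rw [hg]; dsimp only; rw [F_arc₀ hF ℓ ⟨hx.1.le, hx.2.le⟩]; simp)
  have A1 := integral_le_affine_cos (p := 0.4978) (q := 0) h12 hint1
    (fun x hx ↦ by rw [hg]; dsimp only; rw [F_arc₁ hF ℓ ⟨hx.1, hx.2.le⟩]; simp)
  have A2 := integral_le_affine_cos (p := 1.533) (q := 2 * (0.4978 - 1.533)) h23 hint2
    (fun x hx ↦ (F_arc₂ hF ℓ ⟨hx.1, hx.2.le⟩).le)
  have A3 := integral_le_affine_cos (p := 1.542) (q := 1.1804 - ℓ / 2) h34 hint3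
    (fun x hx ↦ (F_arc₃ hF ℓ ⟨hx.1, hx.2.le⟩).le)
  have A4 := integral_le_affine_cos (p := 2.2026 - ℓ / 4) (q := 1.5016 - ℓ) h45 hint4
    (fun x hx ↦ (F_arc₄ hF ℓ ⟨hx.1, hx.2.le⟩).le)
  have hI02 := hint0.trans hint1
  have hI03 := hI02.trans hint2
  have hI04 := hI03.trans hint3
  have hI0π : IntervalIntegrable g volume 0 π := hI04.trans hint4
  have s1 := intervalIntegral.integral_add_adjacent_intervals hint0 hint1
  have s2 := intervalIntegral.integral_add_adjacent_intervals hI02 hint2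
  have s3 := intervalIntegral.integral_add_adjacent_intervals hI03 hint3
  have s4 := intervalIntegral.integral_add_adjacent_intervals hI04 hint4
  refine ⟨hI0π, 0.3043 * (π / 6 - 0) + 0 * (Real.sin (π / 6) - Real.sin 0)
      + (0.4978 * (π / 3 - π / 6) + 0 * (Real.sin (π / 3) - Real.sin (π / 6)))
      + (1.533 * (π / 2 - π / 3) + 2 * (0.4978 - 1.533) * (Real.sin (π / 2) - Real.sin (π / 3)))
      + (1.542 * (2 * π / 3 - π / 2) + (1.1804 - ℓ / 2) * (Real.sin (2 * π / 3) - Real.sin (π / 2)))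
      + ((2.2026 - ℓ / 4) * (π - 2 * π / 3) + (1.5016 - ℓ) * (Real.sin π - Real.sin (2 * π / 3))),
    by linarith, fun hℓ ↦ final_numeric hℓ⟩

/-! ### The main estimate at a height that is not an ordinate -/

/-- **Explicit Backlund bound off the ordinates.** For `T ≥ 30` that is not the ordinate of a
zero of `ζ`, `|S(T)| ≤ 0.3083 log T + 3.24`.  Proof: Backlund's formula
(`Literature.NumberTheory.LFunctions.pi_mul_zetaArgS_eq`), the vertical term `≤ 0.71`
(`abs_im_integral_logDeriv_riemannZeta_vertical_le_sharp`), and for the horizontal term the sharp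
Backlund lemma `Literature.Analysis.Complex.abs_im_integral_logDeriv_le_of_circleAverage_le` on the
discs `|s - (5/4 + iT)| ≤ 3/4 < 3/2` with the majorant `exp F(σ)` of this file (regions
`σ ≥ σs`, `[2, σs)`, `[5/4, 2)`, `[1/2, 5/4)`, `[-1/4, 1/2)`, which change exactly at the angles
`π/6, π/3, π/2, 2π/3` of the circle, so that the circle average is computed in closed form),
and the lower bound `|ζ(5/4+iT)| ≥ ζ(5/2)/ζ(5/4) ≥ e^{-1.247}` at the centre.
[cite: Titchmarsh1986, Thm. 9.4] [cite: HasanalizadeShenWong2022, §3] -/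
theorem abs_zetaArgS_le_of_not_ordinate_explicit {T : ℝ} (hT : 30 ≤ T)
    (hT' : ∀ ρ : ℂ, riemannZeta ρ = 0 → ρ.im ≠ T) :
    |zetaArgS T| ≤ 0.3083 * Real.log T + 3.24 := by
  have hT0 : 0 < T := by linarith
  have hπ := Real.pi_pos
  set ℓ := Real.log T with hℓdef
  have hℓ : 3.401 ≤ ℓ := by
    rw [hℓdef, Real.le_log_iff_exp_le hT0]; exact exp_le_thirty.trans hT
  obtain ⟨Fm, hFm⟩ : ∃ Fm : ℝ → ℝ → ℝ, Fm = (fun (ℓ σ : ℝ) ↦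
      if σ < 1 / 2 then 1 / 2 + (1 / 2 - σ) * (ℓ - 1.788)
        + ((5 / 4 - (1 - σ)) / (3 / 4) * 0.9283 + (1 - (5 / 4 - (1 - σ)) / (3 / 4)) * 1.533
          + (5 / 4 - (1 - σ)) / (3 / 4) / 4 * (ℓ + 0.058) + 0.009)
      else if σ < 5 / 4 then (5 / 4 - σ) / (3 / 4) * 0.9283 + (1 - (5 / 4 - σ) / (3 / 4)) * 1.533
          + (5 / 4 - σ) / (3 / 4) / 4 * (ℓ + 0.058) + 0.009
      else if σ < 2 then 1.533 + (σ - 5 / 4) * (4 / 3) * (0.4978 - 1.533)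
      else if σ < 5 / 4 + 3 / 2 * (Real.sqrt 3 / 2) then 0.4978 else 0.3043) := ⟨_, rfl⟩
  set B : ℂ → ℝ := fun z ↦ Real.exp (Fm ℓ z.re) with hB
  -- geometry of the circle
  have hsphere : ∀ z ∈ sphere ((5 / 4 : ℝ) : ℂ) (3 / 2), |z.re - 5 / 4| ≤ 3 / 2 ∧ |z.im| ≤ 3 / 2 := by
    intro z hz
    rw [mem_sphere, dist_eq_norm] at hz
    have h1 := abs_re_le_norm (z - ((5 / 4 : ℝ) : ℂ))
    have h2 := abs_im_le_norm (z - ((5 / 4 : ℝ) : ℂ))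
    simp only [sub_re, sub_im, ofReal_re, ofReal_im, sub_zero] at h1 h2
    rw [hz] at h1 h2
    exact ⟨h1, h2⟩
  have hBound : ∀ z ∈ sphere ((5 / 4 : ℝ) : ℂ) (3 / 2),
      ‖riemannZeta (z + T * I)‖ ≤ B z ∧ ‖riemannZeta (conj z + T * I)‖ ≤ B z := by
    intro z hz
    obtain ⟨h1, h2⟩ := hsphere z hz
    rw [abs_le] at h1 h2
    constructor
    · have := norm_riemannZeta_le_exp_F hFm hT (w := z + T * I) (by simp; linarith) (by simp; linarith)
        (by simp; linarith)
      rw [← hℓdef] at this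
      simpa [hB] using this
    · have := norm_riemannZeta_le_exp_F hFm hT (w := conj z + T * I) (by simp; linarith)
        (by simp; linarith) (by simp; linarith)
      rw [← hℓdef] at this
      simpa [hB] using this
  have hB1 : ∀ z ∈ sphere ((5 / 4 : ℝ) : ℂ) (3 / 2), 1 ≤ B z := by
    intro z hz
    obtain ⟨h1, -⟩ := hsphere z hz
    rw [abs_le] at h1
    exact Real.one_le_exp (F_nonneg hFm hℓ (by linarith))
  -- circle integrability and the circle average
  obtain ⟨hI0π, X, hIle, hnum⟩ := integral_F_le hFm ℓ
  have hlogB : (fun z ↦ Real.log (B z)) = fun z ↦ Fm ℓ z.re := by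
    funext z; simp only [hB, Real.log_exp]
  have hgint2 : IntervalIntegrable (fun θ ↦ Fm ℓ (5 / 4 + 3 / 2 * Real.cos θ)) volume π (2 * π) := by
    have h := hI0π.comp_sub_left (2 * π)
    simp only [Real.cos_two_pi_sub] at h
    rw [show 2 * π - 0 = 2 * π by ring, show 2 * π - π = π by ring] at h
    exact h.symm
  have hBi : CircleIntegrable (fun z ↦ Real.log (B z)) ((5 / 4 : ℝ) : ℂ) (3 / 2) := by
    rw [hlogB]
    unfold CircleIntegrable
    simp only [Literature.Analysis.Complex.circleMap_ofReal_re]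
    exact hI0π.trans hgint2
  have hA : Real.circleAverage (fun z ↦ Real.log (B z)) ((5 / 4 : ℝ) : ℂ) (3 / 2) ≤ π⁻¹ * X := by
    rw [hlogB, circleAverage_re_eq' (b := Fm ℓ) (c := 5 / 4) (R := 3 / 2) hI0π]
    exact mul_le_mul_of_nonneg_left hIle (inv_nonneg.2 hπ.le)
  -- the sharp Backlund lemma on `|s - (5/4 + iT)| ≤ 3/4 < 3/2`
  have hg_an : ∀ z ∈ closedBall (((5 / 4 : ℝ) : ℂ) + T * I) (3 / 2), AnalyticAt ℂ riemannZeta z := by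
    intro z hz
    apply analyticOn_riemannZeta
    intro hz1
    rw [Set.mem_singleton_iff] at hz1
    rw [mem_closedBall, dist_eq_norm, hz1] at hz
    have h := abs_im_le_norm (1 - (((5 / 4 : ℝ) : ℂ) + T * I))
    simp only [sub_im, one_im, add_im, ofReal_im, mul_im, ofReal_re, I_im, I_re, mul_one, mul_zero,
      add_zero, zero_add, zero_sub, abs_neg] at h
    rw [abs_of_pos hT0] at h
    linarith
  have hc0 : riemannZeta (((5 / 4 : ℝ) : ℂ) + T * I) ≠ 0 :=
    riemannZeta_ne_zero_of_one_lt_re (by simp; norm_num)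
  have h0 : ∀ x ∈ Icc (1 / 2 : ℝ) 2, riemannZeta (x + T * I) ≠ 0 := fun x _ h ↦ hT' _ h (by simp)
  have hH := Literature.Analysis.Complex.abs_im_integral_logDeriv_le_of_circleAverage_le
    (g := riemannZeta) (B := B) (c := 5 / 4) (y := T) (r := 3 / 4) (R := 3 / 2) (A := π⁻¹ * X)
    (a := 1 / 2) (b := 2) (by norm_num) (by norm_num) hg_an hc0 hBound hB1 hBi hA (by norm_num)
    (by norm_num) (by norm_num) h0
  have hlog2 : Real.log (3 / 2 / (3 / 4)) = Real.log 2 := by norm_num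
  rw [hlog2] at hH
  have hlow := neg_le_log_norm_riemannZeta_five_fourths_add T
  have hlog2pos : 0 < Real.log 2 := Real.log_pos (by norm_num)
  have hH' : |(∫ x : ℝ in (1 / 2 : ℝ)..2, deriv riemannZeta (x + T * I) / riemannZeta (x + T * I)).im| ≤
      π * (π⁻¹ * X + 1.247) / Real.log 2 := by
    refine hH.trans ?_
    apply div_le_div_of_nonneg_right _ hlog2pos.le
    apply mul_le_mul_of_nonneg_left _ hπ.le
    linarith
  -- assembly
  have hmain := pi_mul_zetaArgS_eq hT0 hT'
  have hv := abs_im_integral_logDeriv_riemannZeta_vertical_le_sharp hT0.le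
  have key : π * |zetaArgS T| ≤ 0.71 + π * (π⁻¹ * X + 1.247) / Real.log 2 := by
    rw [← abs_of_pos hπ, ← abs_mul, abs_of_pos hπ, hmain]
    exact (abs_sub _ _).trans (add_le_add hv hH')
  have key2 : |zetaArgS T| ≤ 0.71 / π + (π⁻¹ * X + 1.247) / Real.log 2 := by
    have h2 : |zetaArgS T| * π ≤ (0.71 / π + (π⁻¹ * X + 1.247) / Real.log 2) * π := by
      have : (0.71 / π + (π⁻¹ * X + 1.247) / Real.log 2) * π =
          0.71 + π * (π⁻¹ * X + 1.247) / Real.log 2 := by field_simp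
      rw [this, mul_comm]; exact key
    exact le_of_mul_le_mul_right h2 hπ
  exact key2.trans (hnum hℓ)

end ZetaArgBacklund

/-! ### All heights `T ≥ 30` -/

/-- **An explicit Backlund bound for `S(T)`**: for every `T ≥ 30`,
`|S(T)| ≤ 0.3083 log T + 3.24`.  At an ordinate one passes to non-ordinates `T'' ↓ T` with
`N(T'') = N(T)` (right continuity of `N`) and uses the continuity of `θ` and of the bound.
[cite: Titchmarsh1986, Thm. 9.4] -/
theorem abs_zetaArgS_le_explicit {T : ℝ} (hT : 30 ≤ T) : |zetaArgS T| ≤ 0.3083 * Real.log T + 3.24 := by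
  have hT0 : 0 < T := by linarith
  have hπ := Real.pi_pos
  have hπ3 := Real.pi_gt_three
  refine le_of_forall_pos_le_add fun δ hδ ↦ ?_
  set C := 1 + Real.log (T + 1) / 2 with hC
  have hC0 : 0 < C := by
    have : 0 ≤ Real.log (T + 1) := Real.log_nonneg (by linarith)
    rw [hC]; linarith
  set K := 0.3083 / T + C / π + 1 with hK
  have hK0 : 0 < K := by rw [hK]; positivity
  set ε := min (1 / 2) (δ / K) with hε
  have hε0 : 0 < ε := by rw [hε]; exact lt_min (by norm_num) (div_pos hδ hK0)
  have hε1 : ε ≤ 1 / 2 := min_le_left _ _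
  have hεK : ε * K ≤ δ := by
    have : ε ≤ δ / K := min_le_right _ _
    rwa [le_div_iff₀ hK0] at this
  obtain ⟨T', h1, h2, h3⟩ := exists_gt_no_ordinate (T := T) hT0.le
  set T'' := min T' (T + ε) with hT''
  have hTT'' : T < T'' := lt_min h1 (by linarith)
  have hT''le : T'' ≤ T + ε := min_le_right _ _
  have hT''le' : T'' ≤ T' := min_le_left _ _
  have h3'' : ∀ ρ : ℂ, riemannZeta ρ = 0 → ¬(T < ρ.im ∧ ρ.im ≤ T'') := fun ρ hρ ⟨ha, hb⟩ ↦
    h3 ρ hρ ⟨ha, hb.trans hT''le'⟩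
  have hN : zetaZeroCount T'' = zetaZeroCount T := zetaZeroCount_eq_of_no_ordinate hTT''.le h3''
  have hT''ord : ∀ ρ : ℂ, riemannZeta ρ = 0 → ρ.im ≠ T'' := fun ρ hρ he ↦
    h3'' ρ hρ ⟨by rw [he]; exact hTT'', he.le⟩
  have hS'' := ZetaArgBacklund.abs_zetaArgS_le_of_not_ordinate_explicit (by linarith : 30 ≤ T'') hT''ord
  have hθ := ZetaArgVariation.abs_riemannSiegelTheta_sub_le (by linarith : 7 ≤ T) hTT''.le (by linarith)
  have hdiff : zetaArgS T = zetaArgS T'' + (riemannSiegelTheta T'' - riemannSiegelTheta T) / π := by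
    simp only [zetaArgS, hN]
    field_simp
    ring
  -- `log T'' ≤ log T + ε/T`
  have hT''0 : 0 < T'' := by linarith
  have hlog : Real.log T'' ≤ Real.log T + ε / T := by
    have h1 : Real.log T'' ≤ Real.log (T + ε) := Real.log_le_log hT''0 hT''le
    have h2 : Real.log (T + ε) - Real.log T ≤ ε / T := by
      rw [← Real.log_div (by linarith) hT0.ne']
      have := Real.log_le_sub_one_of_pos (show 0 < (T + ε) / T by positivity)
      rw [show (T + ε) / T - 1 = ε / T by field_simp; ring] at this
      exact this
    linarith
  have hθ' : |(riemannSiegelTheta T'' - riemannSiegelTheta T) / π| ≤ C * ε / π := by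
    rw [abs_div, abs_of_pos hπ]
    apply div_le_div_of_nonneg_right _ hπ.le
    refine hθ.trans ?_
    rw [← hC]
    exact mul_le_mul_of_nonneg_left (by linarith) hC0.le
  rw [hdiff]
  have h4 := abs_add_le (zetaArgS T'') ((riemannSiegelTheta T'' - riemannSiegelTheta T) / π)
  have h5 : 0.3083 * Real.log T'' ≤ 0.3083 * Real.log T + 0.3083 / T * ε := by
    have := mul_le_mul_of_nonneg_left hlog (by norm_num : (0 : ℝ) ≤ 0.3083)
    linarith [show 0.3083 * (ε / T) = 0.3083 / T * ε by ring]
  have h6 : 0.3083 / T * ε + C * ε / π ≤ ε * K := by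
    have e : ε * (0.3083 / T + C / π + 1) = 0.3083 / T * ε + C * ε / π + ε := by ring
    rw [hK, e]
    linarith
  linarith

/-! ### Consequence: Corollary 1.2 of Hasanalizade–Shen–Wong needs only their Theorem 1.3 -/

/-- `(T/2π) log(T/(2πe)) ≥ -1` for `T > 0` (`x log x ≥ -1/e`). [folklore] -/
lemma neg_one_le_main (T : ℝ) (hT : 0 < T) : -1 ≤ T / (2 * π) * Real.log (T / (2 * π * Real.exp 1)) := by
  have hπ := Real.pi_pos
  set u := T / (2 * π * Real.exp 1) with hu
  have hu0 : 0 < u := by positivity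
  have he := Real.exp_pos 1
  have hTu : T / (2 * π) = Real.exp 1 * u := by rw [hu]; field_simp
  have h := Real.self_sub_one_le_mul_log (show 0 ≤ Real.exp 1 * u by positivity)
  rw [Real.log_mul he.ne' hu0.ne', Real.log_exp] at h
  rw [hTu]
  nlinarith

/-- `(T/2π) log(T/(2πe)) ≤ 2.81` for `0 < T ≤ 30`. [folklore] -/
lemma main_le_of_le_thirty {T : ℝ} (hT : 0 < T) (hT30 : T ≤ 30) :
    T / (2 * π) * Real.log (T / (2 * π * Real.exp 1)) ≤ 2.81 := by
  have hπ := Real.pi_pos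
  have hπ3 := Real.pi_gt_d6
  have he := Real.exp_pos 1
  have he1 := Real.exp_one_gt_d9
  rcases le_or_gt (T / (2 * π * Real.exp 1)) 1 with h1 | h1
  · have : Real.log (T / (2 * π * Real.exp 1)) ≤ 0 := Real.log_nonpos (by positivity) h1
    have : T / (2 * π) * Real.log (T / (2 * π * Real.exp 1)) ≤ 0 :=
      mul_nonpos_iff.2 (Or.inl ⟨by positivity, this⟩)
    linarith
  · have hlog0 : 0 ≤ Real.log (T / (2 * π * Real.exp 1)) := Real.log_nonneg h1.le
    have hprod : 3.141592 * 2.7182818283 ≤ π * Real.exp 1 := mul_le_mul hπ3.le he1.le (by norm_num) hπ.le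
    have hq : T / (2 * π * Real.exp 1) ≤ 1.8 := by
      rw [div_le_iff₀ (by positivity)]; nlinarith
    have hlog : Real.log (T / (2 * π * Real.exp 1)) ≤ 0.588 := by
      refine (Real.log_le_log (by positivity) hq).trans ?_
      rw [Real.log_le_iff_le_exp (by norm_num)]
      refine le_trans ?_ (Real.sum_le_exp_of_nonneg (by norm_num) 7)
      norm_num [Finset.sum_range_succ, Nat.factorial]
    have hT2π : T / (2 * π) ≤ 4.775 := by rw [div_le_iff₀ (by positivity)]; linarith
    calc T / (2 * π) * Real.log (T / (2 * π * Real.exp 1)) ≤ 4.775 * 0.588 := by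
          apply mul_le_mul hT2π hlog hlog0 (by norm_num)
      _ ≤ 2.81 := by norm_num

/-- `N(30) ≤ 7` (from `N = θ/π + 1 + S`, Stirling for `θ(30)` and the explicit bound for `S(30)`).
[folklore] -/
lemma zetaZeroCount_thirty_le : zetaZeroCount 30 ≤ 7 := by
  have hπ := Real.pi_pos
  have hπ1 := Real.pi_gt_d6
  have hπ2 := Real.pi_lt_d6
  have hS := abs_zetaArgS_le_explicit (le_refl (30 : ℝ))
  have hθ := abs_riemannSiegelTheta_sub_stirling_le (t := 30) (by norm_num)
  have hK := stirlingVertRate_quarter_lt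
  -- `log 30 ≤ 5 log 2 ≤ 3.4658`, `log(30/2π) ≤ log 4.8 ≤ 1.57`
  have hl2 := Real.log_two_lt_d9
  have hlog30 : Real.log 30 ≤ 3.4658 := by
    have : Real.log 30 ≤ Real.log 32 := Real.log_le_log (by norm_num) (by norm_num)
    rw [show (32 : ℝ) = 2 ^ 5 by norm_num, Real.log_pow] at this
    push_cast at this; linarith
  have hlogq : Real.log (30 / (2 * π)) ≤ 1.57 := by
    have hq : 30 / (2 * π) ≤ 4.8 := by rw [div_le_iff₀ (by positivity)]; linarith
    refine (Real.log_le_log (by positivity) hq).trans ?_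
    rw [Real.log_le_iff_le_exp (by norm_num)]
    refine le_trans ?_ (Real.sum_le_exp_of_nonneg (by norm_num) 7)
    norm_num [Finset.sum_range_succ, Nat.factorial]
  have hreal : (zetaZeroCount 30 : ℝ) < 8 := by
    rw [zetaZeroCount_eq_theta_add_zetaArgS]
    rw [abs_le] at hS hθ
    have hK' : 2 * stirlingVertRate (1 / 4) / 30 ≤ 0.04 := by
      rw [div_le_iff₀ (by norm_num)]; linarith
    have hθle : riemannSiegelTheta 30 ≤ 8.2 := by nlinarith
    have hdiv : riemannSiegelTheta 30 / π ≤ 8.2 / 3.141592 := by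
      calc riemannSiegelTheta 30 / π ≤ 8.2 / π := div_le_div_of_nonneg_right hθle hπ.le
        _ ≤ 8.2 / 3.141592 := div_le_div_of_nonneg_left (by norm_num) (by norm_num) hπ1.le
    norm_num at hdiv ⊢
    nlinarith
  have : (zetaZeroCount 30 : ℝ) < ((8 : ℕ) : ℝ) := by exact_mod_cast hreal
  have h8 : zetaZeroCount 30 < 8 := by exact_mod_cast this
  omega

/-- **Corollary 1.2 of Hasanalizade–Shen–Wong from their Theorem 1.3 alone.**  The source proves
Corollary 1.2 from Theorem 1.1/1.3 (at `T₀ = 30 610 046 000`, Table 2) for `T ≥ T₀` and from Platt's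
database of zeros ((1.7): `|S(T)| ≤ 2.5167` for `T ≤ T₀`) below `T₀`.  Here the database input is
replaced by the explicit Backlund bound `|S(T)| ≤ 0.3083 log T + 3.24` (`T ≥ 30`,
`abs_zetaArgS_le_explicit`), which at `T = T₀` still leaves `|N(T) − M(T)| ≤ 0.3083·24.26 + 4.13 < 0.1038 log T₀ + 9.3675`,
and by `N(T) ≤ N(30) ≤ 7`, `-1 ≤ M(T) ≤ 2.81` on `e ≤ T ≤ 30`.  So the named fact
`Literature.NumberTheory.LFunctions.zetaZeroCount_hasanalizade_shen_wong` follows from the single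
analytic input `h₁` = **Theorem 1.3** of the source at Table 2, row 1.
[cite: HasanalizadeShenWong2022, Corollary 1.2, Theorem 1.3 (Table 2, row 1)] -/
theorem zetaZeroCount_hasanalizade_shen_wong_of_large
    (h₁ : ∀ T : ℝ, 30610046000 ≤ T →
      |zetaArgS T| ≤ 0.103787 * Real.log T + 0.257297 * Real.log (Real.log T) + 8.367419) :
    zetaZeroCount_hasanalizade_shen_wong := by
  intro T hT
  have he := Real.exp_one_gt_d9
  have he' := Real.exp_one_lt_d9
  have hπ3 := Real.pi_gt_three
  have hπ := Real.pi_pos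
  have hT2 : 2 ≤ T := by linarith
  have hT0 : 0 < T := by linarith
  obtain ⟨hL1, hLL0⟩ := one_le_log_of_exp_one_le hT
  rcases lt_or_ge T 30 with hsmall | hmid
  · -- `e ≤ T < 30`: `0 ≤ N(T) ≤ 7` and `-1 ≤ M(T) ≤ 2.81`
    have hN : zetaZeroCount T ≤ 7 := (zetaZeroCount_mono hsmall.le).trans zetaZeroCount_thirty_le
    have hN' : (zetaZeroCount T : ℝ) ≤ 7 := by exact_mod_cast hN
    have hN0 : (0 : ℝ) ≤ zetaZeroCount T := Nat.cast_nonneg _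
    have hM1 := neg_one_le_main T hT0
    have hM2 := main_le_of_le_thirty hT0 hsmall.le
    rw [abs_le]
    constructor <;> nlinarith
  rcases le_or_gt T 30610046000 with hsmall | hlarge
  · -- `30 ≤ T ≤ T₀`: the explicit Backlund bound
    have hS := abs_zetaArgS_le_explicit hmid
    have hD := abs_zetaZeroCount_sub_main_le_of_abs_zetaArgS_le hT2 hS
    have hl2 := Real.log_two_lt_d9
    have hL : Real.log T ≤ 24.2602 := by
      have : Real.log T ≤ Real.log (2 ^ 35) := Real.log_le_log hT0 (by norm_num at hsmall ⊢; linarith)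
      rw [Real.log_pow] at this; push_cast at this; linarith
    have hErr : 1.2 / (π * T) ≤ 0.014 := by
      rw [div_le_iff₀ (by positivity)]; nlinarith
    nlinarith
  · -- `T ≥ T₀`: Theorem 1.3; the `Γ`-factor error is `≤ 1.2/(3T₀) < 10⁻³`
    have hErr : 1.2 / (π * T) ≤ 0.001 := by
      rw [div_le_iff₀ (by positivity)]
      nlinarith
    have hD := abs_zetaZeroCount_sub_main_le_of_abs_zetaArgS_le hT2 (h₁ T hlarge.le)
    nlinarith

/-! ### Explicit bounds for `N(T)` -/

/-- **Explicit zero counting, `T ≥ 30`**: `|N(T) − (T/2π) log(T/2πe)| ≤ 0.3083 log T + 4.128`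
(the Backlund bound for `S(T)`, `7/8`, and the Stirling error `1.2/(πT) ≤ 0.013`). [folklore] -/
theorem abs_zetaZeroCount_sub_main_le_explicit {T : ℝ} (hT : 30 ≤ T) :
    |(zetaZeroCount T : ℝ) - T / (2 * π) * Real.log (T / (2 * π * Real.exp 1))|
      ≤ 0.3083 * Real.log T + 4.128 := by
  have hπ := Real.pi_pos
  have hπ3 := Real.pi_gt_d2
  have hD := abs_zetaZeroCount_sub_main_le_of_abs_zetaArgS_le (by linarith) (abs_zetaArgS_le_explicit hT)
  have hErr : 1.2 / (π * T) ≤ 0.013 := by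
    rw [div_le_iff₀ (by positivity)]; nlinarith
  linarith

/-- **Explicit zero counting, `T ≥ e`**: `|N(T) − (T/2π) log(T/2πe)| ≤ 0.3083 log T + 7.7`
(on `[e, 30)`: `0 ≤ N(T) ≤ 7`, `-1 ≤ (T/2π)log(T/2πe) ≤ 2.81`). [folklore] -/
theorem abs_zetaZeroCount_sub_main_le_explicit' {T : ℝ} (hT : Real.exp 1 ≤ T) :
    |(zetaZeroCount T : ℝ) - T / (2 * π) * Real.log (T / (2 * π * Real.exp 1))|
      ≤ 0.3083 * Real.log T + 7.7 := by
  have he := Real.exp_one_gt_d9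
  have hT0 : 0 < T := by linarith
  obtain ⟨hL1, -⟩ := one_le_log_of_exp_one_le hT
  rcases lt_or_ge T 30 with hsmall | hbig
  · have hN : zetaZeroCount T ≤ 7 := (zetaZeroCount_mono hsmall.le).trans zetaZeroCount_thirty_le
    have hN' : (zetaZeroCount T : ℝ) ≤ 7 := by exact_mod_cast hN
    have hN0 : (0 : ℝ) ≤ zetaZeroCount T := Nat.cast_nonneg _
    have hM1 := neg_one_le_main T hT0
    have hM2 := main_le_of_le_thirty hT0 hsmall.le
    rw [abs_le]
    constructor <;> nlinarith
  · have := abs_zetaZeroCount_sub_main_le_explicit hbig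
    linarith

end Literature.NumberTheory.LFunctions

end
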